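import Literature.Barriers.AtomisticToContinuum.DisorderedHarmonicChainTransfer
import Literature.Barriers.AtomisticToContinuum.DisorderedHarmonicChainAdjoint
import Literature.Probability.RandomMatrixProducts.AndersonModel1DEstimates
import Mathlib.Analysis.SpecialFunctions.ImproperIntegrals
import HarnessLib

/-!
# Ajanki–Huveneers 2011, the high-frequency term (H) PROVED from Fürstenberg positivity and uniform large deviations for the Anderson model

Companion, in the Casher–Lebowitz / Ajanki–Huveneers cluster of the barrier catalogue
`Literature/Barriers/AtomisticToContinuum/` (`DisorderedHarmonicChain.lean` — the fact
`AjankiHuveneers2011_scaling`, Thm 1.1 of O. Ajanki, F. Huveneers, CMP **301** (2011) 841–883,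
arXiv:1003.1076; `…Spectral.lean`, `…Transfer.lean`, `…Phases.lean`, `…HighFrequency.lean`), to
`DisorderedHarmonicChainHighFrequency.lean` (provefact unit of the root fact
`AjankiHuveneers2011_scaling`).  `…Transfer.lean` reduced the spectral form of Theorem 1.1 to three
bounds on the mass-averaged current density `𝔼 j_n`; the high-frequency one,

  (H) `AjankiHuveneers2011_highFrequencyBound`: `∫_{ω₀}^∞ 𝔼 j_n ≤ C e^{-c√n}` for every `ω₀ > 0`,

is in the paper a one-line appeal to O'Connor (CMP **45** (1975), Thm 6), and
`…HighFrequency.lean` formalises O'Connor's own proof down to his moderate-deviation input (39)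
(`OConnor1975_amplitudeBound`, resting on his transfer-operator CLT). This file takes the OTHER
classical route and PROVES (H) from two textbook facts about the one-dimensional Anderson model
vendored in
`Literature/Probability/RandomMatrixProducts/AndersonModel1D.lean` from Bucaj–Damanik–Fillman–
Gerbuz–VandenBoom–Wang–Zhang (TAMS **372** (2019), arXiv:1706.06135): Fürstenberg positivity of
the Lyapunov exponent (`BucajEtAl2019_lyapunovPos`, Thm 2.3 there) and the vectorwise uniform
large-deviation theorem (`BucajEtAl2019_vectorLDT`, Prop. 3.6 there):

  `AjankiHuveneers2011_highFrequencyBound_of_anderson :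
     BucajEtAl2019_lyapunovPos → BucajEtAl2019_vectorLDT → AjankiHuveneers2011_highFrequencyBound`.

## The argument (all steps PROVED here)

* The chain's transfer matrices ARE Anderson transfer matrices at energy `E = 2` with potentials
  `ω² m_k`: `T_k(ω) = [[2 - m_kω², -1],[1,0]] = andersonTransfer 2 (ω² m_k)`, and the first column of
  `Q_n = T_{n-1}⋯T_0` is `(D_n(e₁), D_{n-1}(e₁))` (`chainD₁_eq_transferProd`).
* Ultraviolet regime `aω² ≥ 5` (masses `≥ a`): every `T_k` is uniformly hyperbolic,
  `|D_n(e₁)| ≥ (aω² - 3)^n`, hence `j_n ≤ (25/4a²) ω⁻² 4^{-(n-1)}` deterministically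
  (`clCurrentDensity_uv_bound`), integrable in `ω` and exponentially small in `n`.
* Band `ω₀ ≤ ω ≤ Ω`: `j_n ≤ K₀ ‖Q_n e₁‖^{-s}` for ALL masses and any `s ∈ (0,2]`
  (`clCurrentDensity_band_bound`) — the current density is dominated by a negative moment of one
  column of the random matrix product.
* Pointwise core (`chain_logMoment_lower`): for fixed `ω > 0`, positivity `L > 0` (Thm 2.3) and
  the LDT at `ε = L/2` (Prop. 3.6) for the law of `ω²m` give a scale `N` with
  `𝔼 log‖Q_N(ω) v‖ ≥ 2` for every unit `v`.
* Local uniformity: `ω ↦ 𝔼 log‖Q_N(ω)v‖` is Lipschitz on `[0, Ω]` uniformly in `v`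
  (`chain_logMoment_lipschitz`, from the perturbation bound of Bucaj et al. Lemma 3.3 and the
  co-growth `‖Q_N v‖ ≥ K^{-N}`), so `𝔼 log‖Q_N(ω')v‖ ≥ 1` on a ball around `ω`; with
  `e^{-y} ≤ 1 - y + y²` this gives the block contraction `𝔼‖Q_N(ω')v‖^{-s} ≤ 1 - s/2`
  (`chain_block_contraction`).
* Blocks (`chain_negMoment_decay_local`): independence of disjoint blocks of masses
  (`lintegral_pi_fin_add`) and the cocycle identity turn the contraction into
  `𝔼‖Q_n(ω')e₁‖^{-s} ≤ C e^{-cn}`, uniformly on the ball.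
* Compactness of `[ω₀, Ω]` (`clAvgCurrentDensity_band_decay`): finitely many balls, hence
  `𝔼 j_n(ω) ≤ C e^{-cn}` uniformly on the band; with the ultraviolet piece,
  `∫_{ω₀}^∞ 𝔼 j_n ≤ C' e^{-c'n} ≤ C' e^{-c'√n}`.

So, within this cluster, the O'Connor input of AH2011 §6.2 is replaced by Fürstenberg's theorem
and a uniform LDT for i.i.d. `SL(2,ℝ)` products in their modern self-contained form; the rate
obtained is `e^{-cn}`, stronger than the printed `e^{-c√n}`.

Everything downstream of the pointwise core is also stated with the core as an explicit
HYPOTHESIS (`chain_block_contraction_of_core`, `chain_negMoment_decay_local_of_core`,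
`clAvgCurrentDensity_band_decay_of_core`, `AjankiHuveneers2011_highFrequencyBound_of_core`), so
that any other derivation of the core — e.g. from positivity alone for absolutely continuous site
laws (`AndersonModel1DSmoothing.lean`) — yields (H) without the large-deviation input.

## Sources

* O. Ajanki, F. Huveneers, CMP 301 (2011), arXiv:1003.1076: §2 ¶3 (high frequencies contribute
  exponentially little, after O'Connor), §2.1 eqs. (2.3), (2.7), §6.2 (the term `𝒥₃`).
* V. Bucaj, D. Damanik, J. Fillman, V. Gerbuz, T. VandenBoom, F. Wang, Z. Zhang, TAMS 372 (2019)
  3619–3667, arXiv:1706.06135: Thm 2.3, Lemma 3.3, Props. 3.4, 3.6.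
-/

noncomputable section

open MeasureTheory Filter Set
open scoped Matrix.Norms.L2Operator Matrix ENNReal

namespace Literature.Barriers.AtomisticToContinuum.HeatConduction

open Literature.Probability.RandomMatrixProducts

/-! ### The chain's transfer matrices are Anderson transfer matrices at energy `2`

For masses `m : Fin n → ℝ` and frequency `ω` the transfer matrix of site `k` is
`T_k(ω) = [[2 - m_k ω², -1],[1, 0]] = M^2(ω² m_k)` (`andersonTransfer 2 ((ω ^ 2 • m) k)`), and
`Q_k = T_{k-1} ⋯ T_0 = andersonTransferProd 2 (padSeq (ω ^ 2 • m)) k`. -/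

/-- The first column of the transfer product carries `D_k(e₁)`: `(Q_{k+1})₁₀ = (Q_k)₀₀` and
`(Q_{k+1})₀₀ = (E - α_k)(Q_k)₀₀ - (Q_k)₁₀`. [cite: AjankiHuveneers2011, §2.1 eq. (2.3)] -/
theorem andersonTransferProd_col_succ (E : ℝ) (α : ℕ → ℝ) (k : ℕ) :
    andersonTransferProd E α (k + 1) 1 0 = andersonTransferProd E α k 0 0 ∧
    andersonTransferProd E α (k + 1) 0 0 =
      (E - α k) * andersonTransferProd E α k 0 0 - andersonTransferProd E α k 1 0 := by
  rw [andersonTransferProd_succ]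
  constructor
  · simp [Matrix.mul_apply, Fin.sum_univ_two]
  · simp [Matrix.mul_apply, Fin.sum_univ_two]
    ring

/-- `(Q_{k+1})₀₀ = D_{k+1}(e₁)` and `(Q_{k+1})₁₀ = D_k(e₁)` for the diagonal symbol `d_j = E - α_j`.
[cite: AjankiHuveneers2011, §2.1 eq. (2.3)] -/
theorem andersonTransferProd_col_eq_ahD_succ (E : ℝ) (α : ℕ → ℝ) :
    ∀ k, andersonTransferProd E α (k + 1) 0 0 = ahD (fun j => E - α j) 1 0 (k + 1) ∧
      andersonTransferProd E α (k + 1) 1 0 = ahD (fun j => E - α j) 1 0 k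
  | 0 => by
    obtain ⟨h1, h2⟩ := andersonTransferProd_col_succ E α 0
    rw [h1, h2]
    simp
  | k + 1 => by
    obtain ⟨ih00, ih10⟩ := andersonTransferProd_col_eq_ahD_succ E α k
    obtain ⟨h1, h2⟩ := andersonTransferProd_col_succ E α (k + 1)
    refine ⟨?_, ?_⟩
    · rw [h2, ih00, ih10, ahD_add_two]
    · rw [h1, ih00]

/-- `(Q_k)₀₀ = D_k(e₁)` for every `k`. [cite: AjankiHuveneers2011, §2.1 eq. (2.3)] -/
theorem andersonTransferProd_00_eq_ahD (E : ℝ) (α : ℕ → ℝ) (k : ℕ) :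
    andersonTransferProd E α k 0 0 = ahD (fun j => E - α j) 1 0 k := by
  rcases k with _ | k
  · simp
  · exact (andersonTransferProd_col_eq_ahD_succ E α k).1

/-- `(Q_0)₁₀ = 0`. [folklore] -/
theorem andersonTransferProd_zero_10 (E : ℝ) (α : ℕ → ℝ) : andersonTransferProd E α 0 1 0 = 0 := by
  simp

/-- The chain's `D_j(e₁)` in terms of the Anderson product: for `j ≤ n` (number of sites),
`chainD₁ m ω j = (Q_j)₀₀` with `Q_j = andersonTransferProd 2 (padSeq (ω² • m)) j`.
[cite: AjankiHuveneers2011, §2.1 eqs. (2.2)-(2.3)] -/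
theorem chainD₁_eq_transferProd {n : ℕ} (m : Fin n → ℝ) (ω : ℝ) {j : ℕ} (hj : j ≤ n) :
    chainD₁ m ω j = andersonTransferProd 2 (padSeq (ω ^ 2 • m)) j 0 0 := by
  rw [andersonTransferProd_00_eq_ahD 2 (padSeq (ω ^ 2 • m)) j, chainD₁]
  refine ahD_congr 1 0 j fun k hk => ?_
  have hkn : k < n := lt_of_lt_of_le hk hj
  simp [massDiag, finExt, hkn, padSeq_of_lt _ hkn]
  ring

/-- … and `chainD₁ m ω j = (Q_{j+1})₁₀` for `j + 1 ≤ n`. [cite: AjankiHuveneers2011, §2.1 eqs. (2.2)-(2.3)] -/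
theorem chainD₁_eq_transferProd_succ {n : ℕ} (m : Fin n → ℝ) (ω : ℝ) {j : ℕ} (hj : j + 1 ≤ n) :
    chainD₁ m ω j = andersonTransferProd 2 (padSeq (ω ^ 2 • m)) (j + 1) 1 0 := by
  rw [(andersonTransferProd_col_succ 2 _ j).1]
  exact chainD₁_eq_transferProd m ω (by omega)

/-- `‖Q e₁‖² = Q₀₀² + Q₁₀²`. [folklore] -/
theorem norm_sq_toEuclideanLin_e₁ (Q : Matrix (Fin 2) (Fin 2) ℝ) :
    ‖Matrix.toEuclideanLin Q (EuclideanSpace.single (0 : Fin 2) (1 : ℝ))‖ ^ 2 = Q 0 0 ^ 2 + Q 1 0 ^ 2 := by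
  rw [EuclideanSpace.norm_sq_eq]
  simp only [Fin.sum_univ_two, Real.norm_eq_abs, sq_abs]
  have h : ∀ i, (Matrix.toEuclideanLin Q (EuclideanSpace.single (0 : Fin 2) (1 : ℝ))) i = Q i 0 := by
    intro i
    show (Q *ᵥ (EuclideanSpace.single (0 : Fin 2) (1 : ℝ)).ofLp) i = Q i 0
    simp [Matrix.mulVec, dotProduct, EuclideanSpace.single]
  rw [h 0, h 1]

/-! ### The ultraviolet regime: deterministic hyperbolicity for `aω² ≥ 5` -/

/-- **Deterministic growth**: if every diagonal symbol satisfies `d_j ≤ -(c + 1)` with `c ≥ 1`, then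
`|D_k(e₁)| ≥ c^k` and `|D_k(e₁)| ≤ |D_{k+1}(e₁)|`. [folklore] -/
theorem ahD_growth_of_le_neg {d : ℕ → ℝ} {c : ℝ} (hc : 1 ≤ c) :
    ∀ k, (∀ j, j ≤ k → d j ≤ -(c + 1)) →
      c ^ (k + 1) ≤ |ahD d 1 0 (k + 1)| ∧ c * |ahD d 1 0 k| ≤ |ahD d 1 0 (k + 1)| ∧ c ^ k ≤ |ahD d 1 0 k|
  | 0, h => by
    have h0 := h 0 le_rfl
    have : c + 1 ≤ |d 0| := by
      rw [abs_of_neg (by linarith)]; linarith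
    simp only [ahD_one, ahD_zero, mul_one, sub_zero, pow_one, pow_zero, abs_one, zero_add]
    exact ⟨by linarith, by linarith, le_rfl⟩
  | k + 1, h => by
    obtain ⟨ih1, ih2, ih3⟩ := ahD_growth_of_le_neg hc k fun j hj => h j (by omega)
    have hk := h (k + 1) le_rfl
    have hd : c + 1 ≤ |d (k + 1)| := by
      rw [abs_of_neg (by linarith)]; linarith
    have hc0 : 0 ≤ c := by linarith
    -- |D_{k+2}| ≥ |d_{k+1}| |D_{k+1}| - |D_k| ≥ (c+1)|D_{k+1}| - |D_{k+1}| = c |D_{k+1}|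
    have hDk : |ahD d 1 0 k| ≤ |ahD d 1 0 (k + 1)| := by
      have : |ahD d 1 0 k| ≤ c * |ahD d 1 0 k| := le_mul_of_one_le_left (abs_nonneg _) hc
      exact this.trans ih2
    have key : c * |ahD d 1 0 (k + 1)| ≤ |ahD d 1 0 (k + 2)| := by
      rw [ahD_add_two]
      have h1 : |d (k + 1) * ahD d 1 0 (k + 1)| - |ahD d 1 0 k| ≤ |d (k + 1) * ahD d 1 0 (k + 1) - ahD d 1 0 k| :=
        abs_sub_abs_le_abs_sub _ _
      rw [abs_mul] at h1
      nlinarith [abs_nonneg (ahD d 1 0 (k + 1)), hd, h1, hDk]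
    refine ⟨?_, key, ih1⟩
    calc c ^ (k + 1 + 1) = c * c ^ (k + 1) := by ring
      _ ≤ c * |ahD d 1 0 (k + 1)| := by gcongr
      _ ≤ _ := key

/-- **Ultraviolet bound on the current density**: if all masses are `≥ a > 0` and `aω² ≥ 5`
(so every transfer matrix is uniformly hyperbolic, `|2 - m_kω²| ≥ aω² - 2 ≥ 3`), then
`j_n(ω; m) ≤ (25 / (4a²)) ω⁻² 4^{-(n-1)}`. [cite: AjankiHuveneers2011, §2 ¶3 and §6.2 (the term `𝒥₃`; here the elementary part `ω → ∞` of O'Connor's high-frequency estimate)] -/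
theorem clCurrentDensity_uv_bound {k : ℕ} {m : Fin (k + 1) → ℝ} {a ω : ℝ} (ha : 0 < a)
    (hm : ∀ i, a ≤ m i) (hω : 5 ≤ a * ω ^ 2) :
    clCurrentDensity m ω ≤ 25 / (4 * a ^ 2) * (ω ^ 2)⁻¹ * (4 ^ k)⁻¹ := by
  set c : ℝ := a * ω ^ 2 - 3 with hc
  have hc2 : 2 ≤ c := by linarith
  have hc1 : 1 ≤ c := by linarith
  have hω2 : 0 < ω ^ 2 := by nlinarith
  -- the diagonal symbols
  have hd : ∀ j, j ≤ k → massDiag m ω j ≤ -(c + 1) := by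
    intro j hj
    have hjn : j < k + 1 := by omega
    simp only [massDiag, finExt, hjn, dif_pos]
    have := hm ⟨j, hjn⟩
    nlinarith
  obtain ⟨hD, -, -⟩ := ahD_growth_of_le_neg hc1 k hd
  have hc0 : 0 < c := by linarith
  -- |D_{k+1}| ≥ c^{k+1}
  have hDpos : 0 < |chainD₁ m ω (k + 1)| := lt_of_lt_of_le (pow_pos hc0 _) hD
  have hsq : |chainD₁ m ω (k + 1)| ^ 2 = chainD₁ m ω (k + 1) ^ 2 := sq_abs _
  have hD1sq : 0 < chainD₁ m ω (k + 1) ^ 2 := by rw [← hsq]; exact pow_pos hDpos 2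
  have hden_pos : 0 < 2 * ω ^ 2 + chainD₁ m ω (k + 1) ^ 2 +
      ω ^ 2 * (chainD₁ m ω k ^ 2 + chainD₂ m ω (k + 1) ^ 2) + ω ^ 4 * chainD₂ m ω k ^ 2 := by positivity
  rw [clCurrentDensity_succ]
  -- j ≤ ω² / D_{k+1}²
  have step1 : ω ^ 2 / (2 * ω ^ 2 + chainD₁ m ω (k + 1) ^ 2 +
      ω ^ 2 * (chainD₁ m ω k ^ 2 + chainD₂ m ω (k + 1) ^ 2) + ω ^ 4 * chainD₂ m ω k ^ 2) ≤
      ω ^ 2 / chainD₁ m ω (k + 1) ^ 2 := by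
    apply div_le_div_of_nonneg_left hω2.le hD1sq
    nlinarith [sq_nonneg (chainD₁ m ω k), sq_nonneg (chainD₂ m ω (k + 1)), sq_nonneg (chainD₂ m ω k),
      mul_nonneg hω2.le (add_nonneg (sq_nonneg (chainD₁ m ω k)) (sq_nonneg (chainD₂ m ω (k + 1)))),
      mul_nonneg (by positivity : (0:ℝ) ≤ ω ^ 4) (sq_nonneg (chainD₂ m ω k))]
  refine step1.trans ?_
  -- D_{k+1}² ≥ c^{2(k+1)} ≥ (4/25) a² ω⁴ 4^k
  have hD2 : (c ^ (k + 1)) ^ 2 ≤ chainD₁ m ω (k + 1) ^ 2 := by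
    rw [← hsq]; exact pow_le_pow_left₀ (pow_pos hc0 _).le hD 2
  have hc_lower : 2 / 5 * (a * ω ^ 2) ≤ c := by rw [hc]; linarith
  have hck : (4 : ℝ) ^ k ≤ (c ^ k) ^ 2 := by
    have h4 : (4 : ℝ) ≤ c ^ 2 := by nlinarith
    rw [show (c ^ k) ^ 2 = (c ^ 2) ^ k by ring]
    exact pow_le_pow_left₀ (by norm_num) h4 k
  have hmain : (2 / 5 * (a * ω ^ 2)) ^ 2 * 4 ^ k ≤ chainD₁ m ω (k + 1) ^ 2 := by
    calc (2 / 5 * (a * ω ^ 2)) ^ 2 * 4 ^ k ≤ c ^ 2 * (c ^ k) ^ 2 := by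
          gcongr
      _ = (c ^ (k + 1)) ^ 2 := by ring
      _ ≤ _ := hD2
  have hpos4 : (0 : ℝ) < 4 ^ k := by positivity
  rw [div_le_iff₀ hD1sq]
  calc ω ^ 2 = 25 / (4 * a ^ 2) * (ω ^ 2)⁻¹ * (4 ^ k)⁻¹ * ((2 / 5 * (a * ω ^ 2)) ^ 2 * 4 ^ k) := by
        field_simp
        ring
    _ ≤ 25 / (4 * a ^ 2) * (ω ^ 2)⁻¹ * (4 ^ k)⁻¹ * chainD₁ m ω (k + 1) ^ 2 := by
        gcongr


/-! ### The band `ω₀ ≤ ω ≤ Ω`: the current density is controlled by the first column of `Q_n` -/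

/-- `‖Q_n e₁‖ > 0` (`det Q_n = 1`). [folklore] -/
theorem norm_transferProd_e₁_pos (E : ℝ) (α : ℕ → ℝ) (n : ℕ) :
    0 < ‖Matrix.toEuclideanLin (andersonTransferProd E α n) (EuclideanSpace.single (0 : Fin 2) (1 : ℝ))‖ := by
  have h2 := norm_sq_toEuclideanLin_e₁ (andersonTransferProd E α n)
  have hdet := det_andersonTransferProd E α n
  rw [Matrix.det_fin_two] at hdet
  have hne : andersonTransferProd E α n 0 0 ^ 2 + andersonTransferProd E α n 1 0 ^ 2 ≠ 0 := by
    intro h0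
    have h00 : andersonTransferProd E α n 0 0 = 0 := by nlinarith [sq_nonneg (andersonTransferProd E α n 0 0), sq_nonneg (andersonTransferProd E α n 1 0)]
    have h10 : andersonTransferProd E α n 1 0 = 0 := by nlinarith [sq_nonneg (andersonTransferProd E α n 0 0), sq_nonneg (andersonTransferProd E α n 1 0)]
    rw [h00, h10] at hdet
    simp at hdet
  rcases (norm_nonneg (Matrix.toEuclideanLin (andersonTransferProd E α n) (EuclideanSpace.single (0 : Fin 2) (1 : ℝ)))).lt_or_eq with h | h
  · exact h
  · exfalso
    rw [← h] at h2
    simp at h2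
    exact hne h2.symm

/-- **Band comparison**: for `0 < ω₀ ≤ ω ≤ Ω`, every `s ∈ (0, 2]` and ALL masses,
`j_n(ω; m) ≤ K₀ ‖Q_n e₁‖^{-s}` with `K₀ = max(1/2, Ω²/min(1, ω₀²))` and `Q_n = T_{n-1}⋯T_0` the
transfer product of the chain (`j_n = ω²/(2ω² + D_n² + ω²(D_{n-1}² + …) + …) ≤ ω²/(2ω² + c₀‖Q_n e₁‖²)`,
`c₀ = min(1, ω₀²)`, since `Q_n e₁ = (D_n(e₁), D_{n-1}(e₁))`). This is the observation that the
current density is dominated by a negative moment of a single column of the random matrix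
product. [cite: AjankiHuveneers2011, §2 ¶3 ("good control of the exponential decay of `‖Q_n(w)‖` whenever `w ≥ n^{-1/2+ε}`") and §2.1 eq. (2.7)] -/
theorem clCurrentDensity_band_bound {k : ℕ} (m : Fin (k + 1) → ℝ) {ω₀ Ω ω s : ℝ} (hω₀ : 0 < ω₀)
    (hω : ω₀ ≤ ω) (hωΩ : ω ≤ Ω) (hs0 : 0 < s) (hs2 : s ≤ 2) :
    clCurrentDensity m ω ≤ max (1 / 2) (Ω ^ 2 / min 1 (ω₀ ^ 2)) *
      ‖Matrix.toEuclideanLin (andersonTransferProd 2 (padSeq (ω ^ 2 • m)) (k + 1))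
        (EuclideanSpace.single (0 : Fin 2) (1 : ℝ))‖ ^ (-s) := by
  set R : ℝ := ‖Matrix.toEuclideanLin (andersonTransferProd 2 (padSeq (ω ^ 2 • m)) (k + 1))
        (EuclideanSpace.single (0 : Fin 2) (1 : ℝ))‖ with hR
  set K₀ : ℝ := max (1 / 2) (Ω ^ 2 / min 1 (ω₀ ^ 2)) with hK₀
  set c₀ : ℝ := min 1 (ω₀ ^ 2) with hc₀
  have hRpos : 0 < R := norm_transferProd_e₁_pos 2 _ (k + 1)
  have hc₀pos : 0 < c₀ := lt_min one_pos (pow_pos hω₀ 2)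
  have hc₀1 : c₀ ≤ 1 := min_le_left _ _
  have hωpos : 0 < ω := hω₀.trans_le hω
  have hc₀ω : c₀ ≤ ω ^ 2 := (min_le_right _ _).trans (pow_le_pow_left₀ hω₀.le hω 2)
  have hΩ : 0 < Ω := hωpos.trans_le hωΩ
  have hK₀half : 1 / 2 ≤ K₀ := le_max_left _ _
  have hK₀' : Ω ^ 2 / c₀ ≤ K₀ := le_max_right _ _
  have hK₀pos : 0 < K₀ := lt_of_lt_of_le (by norm_num) hK₀half
  -- R² = D_{k+1}² + D_k²
  have hR2 : R ^ 2 = chainD₁ m ω (k + 1) ^ 2 + chainD₁ m ω k ^ 2 := by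
    rw [hR, norm_sq_toEuclideanLin_e₁, ← chainD₁_eq_transferProd m ω le_rfl,
      ← chainD₁_eq_transferProd_succ m ω le_rfl]
  rw [clCurrentDensity_succ]
  have hden_pos : 0 < 2 * ω ^ 2 + chainD₁ m ω (k + 1) ^ 2 +
      ω ^ 2 * (chainD₁ m ω k ^ 2 + chainD₂ m ω (k + 1) ^ 2) + ω ^ 4 * chainD₂ m ω k ^ 2 := by positivity
  -- j ≤ ω² / (2ω² + c₀ R²)
  have step1 : ω ^ 2 / (2 * ω ^ 2 + chainD₁ m ω (k + 1) ^ 2 +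
      ω ^ 2 * (chainD₁ m ω k ^ 2 + chainD₂ m ω (k + 1) ^ 2) + ω ^ 4 * chainD₂ m ω k ^ 2) ≤
      ω ^ 2 / (2 * ω ^ 2 + c₀ * R ^ 2) := by
    apply div_le_div_of_nonneg_left (sq_nonneg ω) (by positivity)
    rw [hR2]
    nlinarith [sq_nonneg (chainD₁ m ω k), sq_nonneg (chainD₂ m ω (k + 1)), sq_nonneg (chainD₂ m ω k),
      sq_nonneg (chainD₁ m ω (k + 1)),
      mul_nonneg (sq_nonneg ω) (sq_nonneg (chainD₂ m ω (k + 1))),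
      mul_nonneg (by positivity : (0:ℝ) ≤ ω ^ 4) (sq_nonneg (chainD₂ m ω k)),
      mul_le_mul_of_nonneg_right hc₀1 (sq_nonneg (chainD₁ m ω (k + 1))),
      mul_le_mul_of_nonneg_right hc₀ω (sq_nonneg (chainD₁ m ω k))]
  refine step1.trans ?_
  rcases le_or_gt 1 R with hR1 | hR1
  · -- R ≥ 1: ω²/(2ω² + c₀R²) ≤ ω²/(c₀ R²) ≤ (Ω²/c₀) R⁻² ≤ K₀ R^{-s}
    have hR2pos : 0 < R ^ 2 := by positivity
    have h1 : ω ^ 2 / (2 * ω ^ 2 + c₀ * R ^ 2) ≤ Ω ^ 2 / c₀ * (R ^ 2)⁻¹ := by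
      rw [div_le_iff₀ (by positivity)]
      have e : Ω ^ 2 / c₀ * (R ^ 2)⁻¹ * (2 * ω ^ 2 + c₀ * R ^ 2) =
          Ω ^ 2 / c₀ * (R ^ 2)⁻¹ * (2 * ω ^ 2) + Ω ^ 2 := by
        field_simp
      rw [e]
      nlinarith [pow_le_pow_left₀ hωpos.le hωΩ 2,
        mul_nonneg (mul_nonneg (div_nonneg (sq_nonneg Ω) hc₀pos.le) (inv_nonneg.mpr hR2pos.le))
          (by positivity : (0:ℝ) ≤ 2 * ω ^ 2)]
    have h2 : (R ^ 2)⁻¹ ≤ R ^ (-s) := by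
      rw [← Real.rpow_natCast R 2, ← Real.rpow_neg hRpos.le]
      exact Real.rpow_le_rpow_of_exponent_le hR1 (by push_cast; linarith)
    calc _ ≤ Ω ^ 2 / c₀ * (R ^ 2)⁻¹ := h1
      _ ≤ K₀ * R ^ (-s) := mul_le_mul hK₀' h2 (inv_nonneg.mpr hR2pos.le) hK₀pos.le
  · -- R < 1: j ≤ 1/2 ≤ K₀ ≤ K₀ R^{-s}
    have h1 : ω ^ 2 / (2 * ω ^ 2 + c₀ * R ^ 2) ≤ 1 / 2 := by
      rw [div_le_iff₀ (by positivity)]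
      nlinarith [mul_nonneg hc₀pos.le (sq_nonneg R)]
    have h2 : 1 ≤ R ^ (-s) := Real.one_le_rpow_of_pos_of_le_one_of_nonpos hRpos hR1.le (by linarith)
    calc _ ≤ 1 / 2 := h1
      _ ≤ K₀ := hK₀half
      _ = K₀ * 1 := (mul_one _).symm
      _ ≤ K₀ * R ^ (-s) := by gcongr


/-! ### The law of the potentials `ω² m_k` and the hypotheses of the Anderson-model facts -/

/-- Under the density hypothesis the single-mass law gives no mass outside `[a, b]`. [folklore] -/
theorem measure_compl_Icc_eq_zero {τ : ℝ → ℝ} {a b : ℝ} (hoff : ∀ s ∉ Set.Icc a b, τ s = 0)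
    {ρ : Measure ℝ} (hρ : ρ = volume.withDensity fun s => ENNReal.ofReal (τ s)) :
    ρ (Set.Icc a b)ᶜ = 0 := by
  rw [hρ, withDensity_apply _ measurableSet_Icc.compl]
  have : ∀ s ∈ (Set.Icc a b)ᶜ, ENNReal.ofReal (τ s) = 0 := fun s hs => by
    rw [hoff s hs, ENNReal.ofReal_zero]
  rw [setLIntegral_congr_fun measurableSet_Icc.compl this, lintegral_zero]

/-- The single-mass law has no atoms. [folklore] -/
theorem measure_singleton_eq_zero {τ : ℝ → ℝ} {ρ : Measure ℝ}
    (hρ : ρ = volume.withDensity fun s => ENNReal.ofReal (τ s)) (x : ℝ) : ρ {x} = 0 := by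
  rw [hρ]
  exact withDensity_absolutelyContinuous _ _ (measure_singleton x)

/-- The law `ν_ω = (x ↦ ω²x)_* ρ` of the site potentials `ω² m_k` is a probability measure. [folklore] -/
theorem isProbabilityMeasure_map_smul (ρ : Measure ℝ) [IsProbabilityMeasure ρ] (c : ℝ) :
    IsProbabilityMeasure (ρ.map fun x => c * x) :=
  Measure.isProbabilityMeasure_map (by fun_prop)

/-- The law of the potentials is carried by `[ω²a, ω²b]`. [folklore] -/
theorem map_smul_compl_Icc_eq_zero {τ : ℝ → ℝ} {a b : ℝ} (hoff : ∀ s ∉ Set.Icc a b, τ s = 0)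
    {ρ : Measure ℝ} (hρ : ρ = volume.withDensity fun s => ENNReal.ofReal (τ s)) {c : ℝ} (hc : 0 < c) :
    (ρ.map fun x => c * x) (Set.Icc (c * a) (c * b))ᶜ = 0 := by
  rw [Measure.map_apply (by fun_prop) measurableSet_Icc.compl]
  have : (fun x => c * x) ⁻¹' (Set.Icc (c * a) (c * b))ᶜ = (Set.Icc a b)ᶜ := by
    ext x
    simp only [Set.preimage_compl, Set.mem_compl_iff, Set.mem_preimage, Set.mem_Icc, not_and, not_le]
    constructor
    · intro h hax
      have := h (by nlinarith)
      nlinarith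
    · intro h hcax
      have := h (by nlinarith)
      nlinarith
  rw [this]
  exact measure_compl_Icc_eq_zero hoff hρ

/-- The support of the law of the potentials is compact. [folklore] -/
theorem isCompact_support_map_smul {τ : ℝ → ℝ} {a b : ℝ} (hoff : ∀ s ∉ Set.Icc a b, τ s = 0)
    {ρ : Measure ℝ} (hρ : ρ = volume.withDensity fun s => ENNReal.ofReal (τ s)) {c : ℝ} (hc : 0 < c) :
    IsCompact (ρ.map fun x => c * x).support := by
  refine (isCompact_Icc (a := c * a) (b := c * b)).of_isClosed_subset Measure.isClosed_support ?_
  refine Measure.support_subset_of_isClosed isClosed_Icc ?_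
  rw [mem_ae_iff]
  exact map_smul_compl_Icc_eq_zero hoff hρ hc

/-- The support of the law of the potentials has at least two points (the law has no atoms). [folklore] -/
theorem support_map_smul_nontrivial {τ : ℝ → ℝ}
    {ρ : Measure ℝ} [IsProbabilityMeasure ρ] (hρ : ρ = volume.withDensity fun s => ENNReal.ofReal (τ s))
    {c : ℝ} (hc : 0 < c) :
    (ρ.map fun x => c * x).support.Nontrivial := by
  set ν : Measure ℝ := ρ.map fun x => c * x with hν
  haveI : IsProbabilityMeasure ν := isProbabilityMeasure_map_smul ρ c
  have hatom : ∀ x, ν {x} = 0 := by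
    intro x
    rw [hν, Measure.map_apply (by fun_prop) (measurableSet_singleton x)]
    have : (fun y => c * y) ⁻¹' {x} = {x / c} := by
      ext y
      simp only [Set.mem_preimage, Set.mem_singleton_iff]
      constructor
      · intro h; rw [← h]; field_simp
      · intro h; rw [h]; field_simp
    rw [this]
    exact measure_singleton_eq_zero hρ _
  by_contra hnt
  rw [Set.not_nontrivial_iff] at hnt
  have huniv : ν Set.univ = 0 := by
    rcases hnt.eq_empty_or_singleton with h | ⟨x, hx⟩
    · have := Measure.measure_compl_support (μ := ν)
      rwa [h, Set.compl_empty] at this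
    · have h1 : ν {x}ᶜ = 0 := by
        have := Measure.measure_compl_support (μ := ν)
        rwa [hx] at this
      have := measure_union_le (μ := ν) {x} {x}ᶜ
      rw [Set.union_compl_self, hatom x, h1, add_zero] at this
      exact le_antisymm this bot_le
  exact (IsProbabilityMeasure.ne_zero ν) (Measure.measure_univ_eq_zero.mp huniv)

/-- The i.i.d. law of the potentials is the image of the i.i.d. law of the masses. [folklore] -/
theorem pi_map_smul (ρ : Measure ℝ) [IsProbabilityMeasure ρ] (c : ℝ) (n : ℕ) :
    (Measure.pi fun _ : Fin n => ρ).map (fun m : Fin n → ℝ => c • m) =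
      Measure.pi fun _ : Fin n => ρ.map fun x => c * x := by
  haveI : IsProbabilityMeasure (ρ.map fun x : ℝ => c * x) := isProbabilityMeasure_map_smul ρ c
  have := Measure.pi_map_pi (μ := fun _ : Fin n => ρ) (f := fun (_ : Fin n) (x : ℝ) => c * x)
    (fun _ => (by fun_prop : Measurable fun x : ℝ => c * x).aemeasurable)
  rw [← this]
  rfl

/-- **The large-deviation event in mass coordinates**: the probability, under the i.i.d. masses, of
the vectorwise large-deviation event of the potentials `ω² m` is at most its probability under
the i.i.d. potentials. [folklore] -/
theorem pi_vectorLDSet_smul_le (ρ : Measure ℝ) [IsProbabilityMeasure ρ] (c E ε : ℝ) (n : ℕ)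
    (v : EuclideanSpace ℝ (Fin 2)) :
    (Measure.pi fun _ : Fin n => ρ) {m | c • m ∈ andersonVectorLDSet (ρ.map fun x => c * x) E ε n v} ≤
      (Measure.pi fun _ : Fin n => ρ.map fun x => c * x) (andersonVectorLDSet (ρ.map fun x => c * x) E ε n v) := by
  rw [← pi_map_smul]
  exact Measure.le_map_apply (by fun_prop : Measurable fun m : Fin n → ℝ => c • m).aemeasurable _

/-! ### Deterministic bounds for masses in `[a, b]` and frequencies `|ω| ≤ Ω` -/

/-- Potentials of masses in `[a,b]` at frequency `|ω| ≤ Ω` satisfy `|2 - ω²m_k| ≤ bΩ² + 2`. [folklore] -/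
theorem abs_two_sub_potential_le {n : ℕ} {m : Fin n → ℝ} {a b Ω ω : ℝ} (ha : 0 < a)
    (hm : ∀ i, a ≤ m i ∧ m i ≤ b) (hω : |ω| ≤ Ω) :
    ∀ k, k < n → |2 - padSeq (ω ^ 2 • m) k| ≤ b * Ω ^ 2 + 2 := by
  intro k hk
  rw [padSeq_of_lt _ hk]
  simp only [Pi.smul_apply, smul_eq_mul]
  obtain ⟨h1, h2⟩ := hm ⟨k, hk⟩
  have hω2 : ω ^ 2 ≤ Ω ^ 2 := by
    rw [← sq_abs ω]; exact pow_le_pow_left₀ (abs_nonneg ω) hω 2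
  have hb : 0 ≤ b := ha.le.trans (h1.trans h2)
  have h3 : 0 ≤ ω ^ 2 * m ⟨k, hk⟩ := mul_nonneg (sq_nonneg ω) (ha.le.trans h1)
  have h4 : ω ^ 2 * m ⟨k, hk⟩ ≤ Ω ^ 2 * b := mul_le_mul hω2 h2 (ha.le.trans h1) (sq_nonneg Ω)
  rw [abs_le]
  constructor <;> nlinarith

/-- **Growth and co-growth for the chain**: for masses in `[a, b]`, `|ω| ≤ Ω` and `K = bΩ² + 3`,
`‖Q_k v‖ ≤ K^k ‖v‖` and `‖v‖ ≤ K^k ‖Q_k v‖` (`k ≤ n`). [folklore] -/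
theorem norm_chainTransfer_apply_bounds {n : ℕ} {m : Fin n → ℝ} {a b Ω ω : ℝ} (ha : 0 < a) (hb : 0 ≤ b)
    (hm : ∀ i, a ≤ m i ∧ m i ≤ b) (hω : |ω| ≤ Ω) (v : EuclideanSpace ℝ (Fin 2)) {k : ℕ} (hk : k ≤ n) :
    ‖Matrix.toEuclideanLin (andersonTransferProd 2 (padSeq (ω ^ 2 • m)) k) v‖ ≤ (b * Ω ^ 2 + 3) ^ k * ‖v‖ ∧
    ‖v‖ ≤ (b * Ω ^ 2 + 3) ^ k * ‖Matrix.toEuclideanLin (andersonTransferProd 2 (padSeq (ω ^ 2 • m)) k) v‖ := by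
  have hD : 0 ≤ b * Ω ^ 2 + 2 := by positivity
  have h := norm_andersonTransferProd_apply_bounds 2 hD (padSeq (ω ^ 2 • m)) v k
    (fun j hj => abs_two_sub_potential_le ha hm hω j (by omega))
  rwa [show b * Ω ^ 2 + 2 + 1 = b * Ω ^ 2 + 3 by ring] at h

/-- Operator-norm growth for the chain, `‖Q_k‖ ≤ K^k`. [folklore] -/
theorem norm_chainTransfer_le {n : ℕ} {m : Fin n → ℝ} {a b Ω ω : ℝ} (ha : 0 < a) (hb : 0 ≤ b)
    (hm : ∀ i, a ≤ m i ∧ m i ≤ b) (hω : |ω| ≤ Ω) {k : ℕ} (hk : k ≤ n) :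
    ‖andersonTransferProd 2 (padSeq (ω ^ 2 • m)) k‖ ≤ (b * Ω ^ 2 + 3) ^ k := by
  have hD : 0 ≤ b * Ω ^ 2 + 2 := by positivity
  have h := norm_andersonTransferProd_le 2 hD (padSeq (ω ^ 2 • m)) k
    (fun j hj => abs_two_sub_potential_le ha hm hω j (by omega))
  rwa [show b * Ω ^ 2 + 2 + 1 = b * Ω ^ 2 + 3 by ring] at h

/-- `|log ‖Q_k v‖| ≤ k log K` for a unit vector `v`, masses in `[a,b]`, `|ω| ≤ Ω`. [folklore] -/
theorem abs_log_norm_chainTransfer_apply_le {n : ℕ} {m : Fin n → ℝ} {a b Ω ω : ℝ} (ha : 0 < a) (hb : 0 ≤ b)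
    (hm : ∀ i, a ≤ m i ∧ m i ≤ b) (hω : |ω| ≤ Ω) {v : EuclideanSpace ℝ (Fin 2)} (hv : ‖v‖ = 1)
    {k : ℕ} (hk : k ≤ n) :
    |Real.log ‖Matrix.toEuclideanLin (andersonTransferProd 2 (padSeq (ω ^ 2 • m)) k) v‖| ≤
      k * Real.log (b * Ω ^ 2 + 3) := by
  obtain ⟨h1, h2⟩ := norm_chainTransfer_apply_bounds ha hb hm hω v hk
  rw [hv, mul_one] at h1
  rw [hv] at h2
  set K : ℝ := b * Ω ^ 2 + 3 with hK
  have hK1 : 1 ≤ K := by rw [hK]; nlinarith [mul_nonneg hb (sq_nonneg Ω)]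
  have hKk : 0 < K ^ k := by positivity
  set R := ‖Matrix.toEuclideanLin (andersonTransferProd 2 (padSeq (ω ^ 2 • m)) k) v‖
  have hRpos : 0 < R := by
    have : (0:ℝ) < 1 := one_pos
    calc (0:ℝ) < (K ^ k)⁻¹ * 1 := by positivity
      _ ≤ (K ^ k)⁻¹ * (K ^ k * R) := by gcongr
      _ = R := by field_simp
  rw [abs_le]
  constructor
  · -- log R ≥ -k log K since R ≥ K^{-k}
    have : (K ^ k)⁻¹ ≤ R := by
      rw [inv_le_iff_one_le_mul₀ hKk]
      linarith [h2]
    have := Real.log_le_log (by positivity) this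
    rw [Real.log_inv, Real.log_pow] at this
    linarith
  · have := Real.log_le_log hRpos h1
    rw [Real.log_pow] at this
    exact this


/-! ### The pointwise core: positivity + large deviations give a scale `N` with `𝔼 log ‖Q_N v‖ ≥ 2` -/

/-- Measurability of `m ↦ ‖Q_k(ω, m) v‖`. [folklore] -/
theorem measurable_norm_chainTransfer_apply {n : ℕ} (ω : ℝ) (k : ℕ) (v : EuclideanSpace ℝ (Fin 2)) :
    Measurable fun m : Fin n → ℝ =>
      ‖Matrix.toEuclideanLin (andersonTransferProd 2 (padSeq (ω ^ 2 • m)) k) v‖ :=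
  (measurable_norm_andersonTransferProd_apply 2 k v).comp
    (by fun_prop : Measurable fun m : Fin n → ℝ => ω ^ 2 • m)

/-- **Pointwise core estimate.** Under Fürstenberg positivity (Bucaj et al. Thm 2.3) and the
vectorwise large-deviation theorem (Prop. 3.6) for the law of the potentials `ω²m_k`
(`ω > 0` fixed), there is a scale `N ≥ 1` such that `𝔼 log ‖Q_N(ω) v‖ ≥ 2` for every unit vector
`v`: with `L = L(2) > 0` and the LDT at `ε = L/2`,
`𝔼 log‖Q_N v‖ ≥ (NL/2)ℙ(good) - N log K ℙ(bad) ≥ NL/2 - N(L/2 + log K) C e^{-ηN} ≥ NL/4 ≥ 2`.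
[cite: BucajEtAl2019, Thm 2.3 and Prop. 3.6] -/
theorem chain_logMoment_lower (hP : BucajEtAl2019_lyapunovPos) (hV : BucajEtAl2019_vectorLDT)
    {τ : ℝ → ℝ} {a b : ℝ} (hyp : MassDensityHyp τ a b) {ρ : Measure ℝ} [IsProbabilityMeasure ρ]
    (hρ : ρ = volume.withDensity fun s => ENNReal.ofReal (τ s)) {Ω ω : ℝ} (hω0 : 0 < ω) (hωΩ : ω ≤ Ω) :
    ∃ N : ℕ, 1 ≤ N ∧ ∀ v : EuclideanSpace ℝ (Fin 2), ‖v‖ = 1 →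
      2 ≤ ∫ m, Real.log ‖Matrix.toEuclideanLin (andersonTransferProd 2 (padSeq (ω ^ 2 • m)) N) v‖
        ∂(Measure.pi fun _ : Fin N => ρ) := by
  have ha := hyp.pos
  have hb : 0 ≤ b := ha.le.trans hyp.lt.le
  have hωabs : |ω| ≤ Ω := by rwa [abs_of_pos hω0]
  set ν : Measure ℝ := ρ.map fun x => ω ^ 2 * x with hν
  haveI : IsProbabilityMeasure ν := isProbabilityMeasure_map_smul ρ _
  have hcpt : IsCompact ν.support := isCompact_support_map_smul hyp.eq_zero hρ (pow_pos hω0 2)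
  have hnt : ν.support.Nontrivial := support_map_smul_nontrivial hρ (pow_pos hω0 2)
  set L : ℝ := andersonLyapunov ν 2 with hL
  have hLpos : 0 < L := hP ν hcpt hnt 2
  obtain ⟨C, η, hC, hη, hLD⟩ := hV ν hcpt hnt (L / 2) (half_pos hLpos)
  have h2mem : (2 : ℝ) ∈ Set.Icc (-andersonKappa ν) (andersonKappa ν) :=
    ⟨by linarith [two_le_andersonKappa ν], two_le_andersonKappa ν⟩
  set K : ℝ := b * Ω ^ 2 + 3 with hK
  have hK1 : 1 ≤ K := by rw [hK]; nlinarith [mul_nonneg hb (sq_nonneg Ω)]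
  have hlogK : 0 ≤ Real.log K := Real.log_nonneg hK1
  set T : ℝ := L / 2 + Real.log K with hT
  have hTpos : 0 < T := by positivity
  -- the scale
  set N : ℕ := ⌈max (8 / L) (4 * C * T / (η * L))⌉₊ + 1 with hN
  have hN1 : 1 ≤ N := by omega
  have hNreal : max (8 / L) (4 * C * T / (η * L)) ≤ (N : ℝ) := by
    rw [hN]
    push_cast
    linarith [Nat.le_ceil (max (8 / L) (4 * C * T / (η * L)))]
  have hN8 : 8 / L ≤ N := (le_max_left _ _).trans hNreal
  have hN4 : 4 * C * T / (η * L) ≤ N := (le_max_right _ _).trans hNreal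
  have hNpos : (0 : ℝ) < N := by exact_mod_cast hN1
  refine ⟨N, hN1, fun v hv => ?_⟩
  -- notation
  set P : Measure (Fin N → ℝ) := Measure.pi fun _ : Fin N => ρ with hP'
  set g : (Fin N → ℝ) → ℝ := fun m =>
    Real.log ‖Matrix.toEuclideanLin (andersonTransferProd 2 (padSeq (ω ^ 2 • m)) N) v‖ with hg
  have hgm : Measurable g := (measurable_norm_chainTransfer_apply ω N v).log
  -- the bad event and its probability
  set bad : Set (Fin N → ℝ) := {m | L / 2 ≤ |1 / (N : ℝ) * g m - L|} with hbad
  have hbad_meas : MeasurableSet bad :=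
    measurableSet_le measurable_const
      (continuous_abs.measurable.comp ((measurable_const.mul hgm).sub measurable_const))
  have hbad_eq : bad = {m | ω ^ 2 • m ∈ andersonVectorLDSet ν 2 (L / 2) N v} :=
    Set.ext fun _ => Iff.rfl
  have hbad_le : P bad ≤ ENNReal.ofReal (C * Real.exp (-(η * N))) := by
    rw [hbad_eq]
    exact (pi_vectorLDSet_smul_le ρ (ω ^ 2) 2 (L / 2) N v).trans (hLD N hN1 v hv 2 h2mem)
  have hbad_real : P.real bad ≤ C * Real.exp (-(η * N)) :=
    ENNReal.toReal_le_of_le_ofReal (by positivity) hbad_le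
  -- a.e. bound on g
  have hae : ∀ᵐ m ∂P, ∀ i, a ≤ m i ∧ m i ≤ b := ae_pi_mem_Icc hyp.eq_zero hρ N
  have hgbound : ∀ᵐ m ∂P, |g m| ≤ N * Real.log K := by
    filter_upwards [hae] with m hm
    exact abs_log_norm_chainTransfer_apply_le ha hb hm hωabs hv le_rfl
  have hgi : Integrable g P := by
    refine Integrable.of_bound hgm.aestronglyMeasurable (N * Real.log K) ?_
    filter_upwards [hgbound] with m hm
    rwa [Real.norm_eq_abs]
  -- the two-valued minorant
  set h : (Fin N → ℝ) → ℝ := fun m => N * L / 2 - (N * L / 2 + N * Real.log K) * bad.indicator 1 m with hh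
  have hhg : ∀ᵐ m ∂P, h m ≤ g m := by
    filter_upwards [hgbound] with m hm
    by_cases hmb : m ∈ bad
    · simp only [hh, Set.indicator_of_mem hmb, Pi.one_apply, mul_one]
      linarith [(abs_le.mp hm).1]
    · simp only [hh, Set.indicator_of_notMem hmb, mul_zero, sub_zero]
      have hlt : |1 / (N : ℝ) * g m - L| < L / 2 := not_le.mp hmb
      have h1 := (abs_lt.mp hlt).1
      have h2 : L / 2 < g m / N := by
        rw [one_div, inv_mul_eq_div] at h1
        linarith
      rw [lt_div_iff₀ hNpos] at h2
      linarith
  have hind : Integrable (bad.indicator (1 : (Fin N → ℝ) → ℝ)) P :=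
    (integrable_const (1 : ℝ)).indicator hbad_meas
  have hhi : Integrable h P := (integrable_const _).sub (hind.const_mul _)
  have hint_h : ∫ m, h m ∂P = N * L / 2 - (N * L / 2 + N * Real.log K) * P.real bad := by
    simp only [hh]
    rw [integral_sub (integrable_const _) (hind.const_mul _), integral_const, integral_const_mul,
      integral_indicator_one hbad_meas]
    simp
  -- the arithmetic
  have hexp : C * Real.exp (-(η * N)) * T ≤ L / 4 := by
    have h1 : Real.exp (-(η * N)) ≤ 1 / (η * N) := by
      have hx : 0 < η * N := by positivity
      rw [Real.exp_neg, ← one_div, one_div_le_one_div (Real.exp_pos _) hx]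
      linarith [Real.add_one_le_exp (η * N)]
    calc C * Real.exp (-(η * N)) * T ≤ C * (1 / (η * N)) * T := by gcongr
      _ = (4 * C * T / (η * L)) * (L / (4 * N)) := by field_simp
      _ ≤ N * (L / (4 * N)) := by gcongr
      _ = L / 4 := by field_simp
  calc (2 : ℝ) ≤ N * L / 4 := by
        have : 8 ≤ N * L := by rwa [div_le_iff₀ hLpos] at hN8
        linarith
    _ ≤ N * L / 2 - (N * L / 2 + N * Real.log K) * (C * Real.exp (-(η * N))) := by
        have : (N * L / 2 + N * Real.log K) * (C * Real.exp (-(η * N))) = N * (C * Real.exp (-(η * N)) * T) := by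
          rw [hT]; ring
        rw [this]
        nlinarith [hexp, hNpos]
    _ ≤ N * L / 2 - (N * L / 2 + N * Real.log K) * P.real bad := by
        have : 0 ≤ N * L / 2 + N * Real.log K := by positivity
        nlinarith [hbad_real, this]
    _ = ∫ m, h m ∂P := hint_h.symm
    _ ≤ ∫ m, g m ∂P := integral_mono_ae hhi hgi hhg


/-! ### Local uniformity in the frequency: Lipschitz dependence and the block contraction -/

/-- `‖Q v‖ > 0` for `v ≠ 0` (`det Q = 1`). [folklore] -/
theorem norm_transferProd_apply_pos (E : ℝ) (α : ℕ → ℝ) (n : ℕ) {v : EuclideanSpace ℝ (Fin 2)} (hv : v ≠ 0) :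
    0 < ‖Matrix.toEuclideanLin (andersonTransferProd E α n) v‖ := by
  rw [norm_pos_iff]
  intro h0
  have hdet := det_andersonTransferProd E α n
  have hv' : v.ofLp ≠ 0 := fun h => hv (by
    apply PiLp.ext; intro i; have := congrFun h i; simpa using this)
  have hmul : andersonTransferProd E α n *ᵥ v.ofLp = 0 := by
    have := congrArg WithLp.ofLp h0
    exact this
  have : (andersonTransferProd E α n).det = 0 :=
    Matrix.exists_mulVec_eq_zero_iff.mp ⟨v.ofLp, hv', hmul⟩
  rw [hdet] at this
  exact one_ne_zero this

/-- **Lipschitz dependence of `𝔼 log ‖Q_N(ω) v‖` on the frequency** (the `ω`-perturbation of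
Bucaj et al. Lemma 3.3 integrated, with the co-growth bound making `log` Lipschitz): for
`|ω|, |ω'| ≤ Ω` and a unit vector `v`,
`|𝔼 log‖Q_N(ω)v‖ - 𝔼 log‖Q_N(ω')v‖| ≤ N b K^{2N} |ω² - ω'²|`, `K = bΩ² + 3`.
[cite: BucajEtAl2019, Lemma 3.3 and Prop. 3.4 (the perturbation step)] -/
theorem chain_logMoment_lipschitz {τ : ℝ → ℝ} {a b : ℝ} (hyp : MassDensityHyp τ a b)
    {ρ : Measure ℝ} [IsProbabilityMeasure ρ] (hρ : ρ = volume.withDensity fun s => ENNReal.ofReal (τ s))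
    {Ω ω ω' : ℝ} (hω : |ω| ≤ Ω) (hω' : |ω'| ≤ Ω) (N : ℕ) {v : EuclideanSpace ℝ (Fin 2)} (hv : ‖v‖ = 1) :
    |(∫ m, Real.log ‖Matrix.toEuclideanLin (andersonTransferProd 2 (padSeq (ω ^ 2 • m)) N) v‖
        ∂(Measure.pi fun _ : Fin N => ρ)) -
      ∫ m, Real.log ‖Matrix.toEuclideanLin (andersonTransferProd 2 (padSeq (ω' ^ 2 • m)) N) v‖
        ∂(Measure.pi fun _ : Fin N => ρ)| ≤
      N * b * (b * Ω ^ 2 + 3) ^ (2 * N) * |ω ^ 2 - ω' ^ 2| := by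
  have ha := hyp.pos
  have hb : 0 ≤ b := ha.le.trans hyp.lt.le
  set K : ℝ := b * Ω ^ 2 + 3 with hK
  have hK1 : 1 ≤ K := by rw [hK]; nlinarith [mul_nonneg hb (sq_nonneg Ω)]
  set P : Measure (Fin N → ℝ) := Measure.pi fun _ : Fin N => ρ
  set f : (Fin N → ℝ) → ℝ := fun m =>
    Real.log ‖Matrix.toEuclideanLin (andersonTransferProd 2 (padSeq (ω ^ 2 • m)) N) v‖ with hf
  set f' : (Fin N → ℝ) → ℝ := fun m =>
    Real.log ‖Matrix.toEuclideanLin (andersonTransferProd 2 (padSeq (ω' ^ 2 • m)) N) v‖ with hf'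
  have hae : ∀ᵐ m ∂P, ∀ i, a ≤ m i ∧ m i ≤ b := ae_pi_mem_Icc hyp.eq_zero hρ N
  have hfi : Integrable f P := by
    refine Integrable.of_bound (measurable_norm_chainTransfer_apply ω N v).log.aestronglyMeasurable
      (N * Real.log K) ?_
    filter_upwards [hae] with m hm
    rw [Real.norm_eq_abs]
    exact abs_log_norm_chainTransfer_apply_le ha hb hm hω hv le_rfl
  have hfi' : Integrable f' P := by
    refine Integrable.of_bound (measurable_norm_chainTransfer_apply ω' N v).log.aestronglyMeasurable
      (N * Real.log K) ?_
    filter_upwards [hae] with m hm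
    rw [Real.norm_eq_abs]
    exact abs_log_norm_chainTransfer_apply_le ha hb hm hω' hv le_rfl
  -- pointwise bound
  have hpt : ∀ᵐ m ∂P, ‖f m - f' m‖ ≤ N * b * K ^ (2 * N) * |ω ^ 2 - ω' ^ 2| := by
    filter_upwards [hae] with m hm
    rw [Real.norm_eq_abs]
    set M := andersonTransferProd 2 (padSeq (ω ^ 2 • m)) N
    set M' := andersonTransferProd 2 (padSeq (ω' ^ 2 • m)) N
    have hKN : 0 < K ^ N := by positivity
    obtain ⟨-, h2⟩ := norm_chainTransfer_apply_bounds ha hb hm hω v (le_refl N)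
    obtain ⟨-, h2'⟩ := norm_chainTransfer_apply_bounds ha hb hm hω' v (le_refl N)
    rw [hv] at h2 h2'
    have hx : (K ^ N)⁻¹ ≤ ‖Matrix.toEuclideanLin M v‖ := by
      rw [inv_le_iff_one_le_mul₀' hKN]; exact h2
    have hy : (K ^ N)⁻¹ ≤ ‖Matrix.toEuclideanLin M' v‖ := by
      rw [inv_le_iff_one_le_mul₀' hKN]; exact h2'
    have hlog := abs_log_sub_log_le (inv_pos.mpr hKN) hx hy
    rw [div_inv_eq_mul] at hlog
    -- ‖Mv‖ - ‖M'v‖ ≤ ‖(M - M') v‖ ≤ ‖M - M'‖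
    have hdiff : |‖Matrix.toEuclideanLin M v‖ - ‖Matrix.toEuclideanLin M' v‖| ≤ ‖M - M'‖ := by
      refine (abs_norm_sub_norm_le _ _).trans ?_
      rw [← LinearMap.sub_apply, ← map_sub]
      have := Matrix.l2_opNorm_mulVec (M - M') v
      rw [hv, mul_one] at this
      exact this
    -- ‖M - M'‖ ≤ N δ K^N
    have hsub : ‖M - M'‖ ≤ N * (b * |ω ^ 2 - ω' ^ 2|) * K ^ N := by
      have hD : 0 ≤ b * Ω ^ 2 + 2 := by positivity
      have := norm_andersonTransferProd_sub_le 2 hD (by positivity : 0 ≤ b * |ω ^ 2 - ω' ^ 2|)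
        (padSeq (ω ^ 2 • m)) (padSeq (ω' ^ 2 • m)) N
        (fun k hk => abs_two_sub_potential_le ha hm hω k hk)
        (fun k hk => abs_two_sub_potential_le ha hm hω' k hk)
        (fun k hk => by
          rw [padSeq_of_lt _ hk, padSeq_of_lt _ hk]
          simp only [Pi.smul_apply, smul_eq_mul]
          rw [← sub_mul, abs_mul, abs_of_nonneg (ha.le.trans (hm ⟨k, hk⟩).1), mul_comm]
          exact mul_le_mul_of_nonneg_right (hm ⟨k, hk⟩).2 (abs_nonneg _))
      rwa [show b * Ω ^ 2 + 2 + 1 = K by rw [hK]; ring] at this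
    calc |f m - f' m| ≤ |‖Matrix.toEuclideanLin M v‖ - ‖Matrix.toEuclideanLin M' v‖| * K ^ N := hlog
      _ ≤ ‖M - M'‖ * K ^ N := by gcongr
      _ ≤ N * (b * |ω ^ 2 - ω' ^ 2|) * K ^ N * K ^ N := by gcongr
      _ = N * b * K ^ (2 * N) * |ω ^ 2 - ω' ^ 2| := by ring
  rw [← integral_sub hfi hfi']
  have := norm_integral_le_of_norm_le_const hpt
  rwa [Real.norm_eq_abs, probReal_univ, mul_one] at this

/-- **Local block contraction from the pointwise core.** If at the frequency `ω ∈ [ω₀, Ω]`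
there is a scale `N` with `𝔼 log‖Q_N(ω) v‖ ≥ 2` for every unit `v` (the "pointwise core", however
obtained), then there are a radius `δ > 0` and an exponent `s ∈ (0, 1]` such that
`𝔼 ‖Q_N(ω') v‖^{-s} ≤ 1 - s/2` for every unit vector `v` and every `ω' ∈ [ω₀, Ω]` with
`|ω' - ω| < δ` (the Lipschitz bound in `ω` and `e^{-y} ≤ 1 - y + y²`).
[cite: BucajEtAl2019, Props. 3.4 and 3.6 (the local-uniformity step)] -/
theorem chain_block_contraction_of_core
    {τ : ℝ → ℝ} {a b : ℝ} (hyp : MassDensityHyp τ a b) {ρ : Measure ℝ} [IsProbabilityMeasure ρ]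
    (hρ : ρ = volume.withDensity fun s => ENNReal.ofReal (τ s)) {ω₀ Ω ω : ℝ} (hω₀ : 0 < ω₀)
    (hω : ω ∈ Set.Icc ω₀ Ω)
    (hcore : ∃ N : ℕ, 1 ≤ N ∧ ∀ v : EuclideanSpace ℝ (Fin 2), ‖v‖ = 1 →
      2 ≤ ∫ m, Real.log ‖Matrix.toEuclideanLin (andersonTransferProd 2 (padSeq (ω ^ 2 • m)) N) v‖
        ∂(Measure.pi fun _ : Fin N => ρ)) :
    ∃ N : ℕ, 1 ≤ N ∧ ∃ δ : ℝ, 0 < δ ∧ ∃ s : ℝ, 0 < s ∧ s ≤ 1 ∧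
      ∀ ω' ∈ Set.Icc ω₀ Ω, |ω' - ω| < δ → ∀ v : EuclideanSpace ℝ (Fin 2), ‖v‖ = 1 →
        ∫ m, ‖Matrix.toEuclideanLin (andersonTransferProd 2 (padSeq (ω' ^ 2 • m)) N) v‖ ^ (-s)
          ∂(Measure.pi fun _ : Fin N => ρ) ≤ 1 - s / 2 := by
  have ha := hyp.pos
  have hb : 0 ≤ b := ha.le.trans hyp.lt.le
  have hωpos : 0 < ω := hω₀.trans_le hω.1
  have hΩ : 0 < Ω := hωpos.trans_le hω.2
  obtain ⟨N, hN1, hcore⟩ := hcore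
  set K : ℝ := b * Ω ^ 2 + 3 with hK
  have hK1 : 1 ≤ K := by rw [hK]; nlinarith [mul_nonneg hb (sq_nonneg Ω)]
  have hlogK : 0 ≤ Real.log K := Real.log_nonneg hK1
  set B : ℝ := N * Real.log K + 1 with hB
  have hB1 : 1 ≤ B := by rw [hB]; nlinarith [mul_nonneg (Nat.cast_nonneg N) hlogK]
  set X : ℝ := N * b * K ^ (2 * N) * (2 * Ω) with hX
  have hX0 : 0 ≤ X := by positivity
  refine ⟨N, hN1, 1 / (X + 1), by positivity, 1 / (2 * B ^ 2), by positivity, ?_, ?_⟩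
  · rw [div_le_iff₀ (by positivity)]; nlinarith
  intro ω' hω' hdist v hv
  have hω'pos : 0 < ω' := hω₀.trans_le hω'.1
  have hωabs : |ω| ≤ Ω := by rw [abs_of_pos hωpos]; exact hω.2
  have hω'abs : |ω'| ≤ Ω := by rw [abs_of_pos hω'pos]; exact hω'.2
  -- 𝔼 log ‖Q_N(ω') v‖ ≥ 1
  have hlip := chain_logMoment_lipschitz hyp hρ hωabs hω'abs N hv
  have hsq : |ω ^ 2 - ω' ^ 2| ≤ 2 * Ω * |ω' - ω| := by
    rw [show ω ^ 2 - ω' ^ 2 = (ω + ω') * (ω - ω') by ring, abs_mul, abs_sub_comm ω ω']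
    gcongr
    rw [abs_le]; constructor <;> linarith [hω.2, hω'.2]
  have hmean : 1 ≤ ∫ m, Real.log ‖Matrix.toEuclideanLin (andersonTransferProd 2 (padSeq (ω' ^ 2 • m)) N) v‖
      ∂(Measure.pi fun _ : Fin N => ρ) := by
    have h1 := hcore v hv
    have h2 := (abs_le.mp hlip).2
    have h3 : N * b * K ^ (2 * N) * |ω ^ 2 - ω' ^ 2| ≤ X * |ω' - ω| := by
      calc N * b * K ^ (2 * N) * |ω ^ 2 - ω' ^ 2| ≤ N * b * K ^ (2 * N) * (2 * Ω * |ω' - ω|) := by gcongr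
        _ = X * |ω' - ω| := by rw [hX]; ring
    have h4 : X * |ω' - ω| ≤ 1 := by
      calc X * |ω' - ω| ≤ X * (1 / (X + 1)) := by gcongr
        _ ≤ 1 := by rw [mul_one_div, div_le_one (by positivity)]; linarith
    linarith
  -- apply the elementary contraction lemma with g = log ‖Q_N(ω') v‖
  have hae : ∀ᵐ m ∂(Measure.pi fun _ : Fin N => ρ), ∀ i, a ≤ m i ∧ m i ≤ b := ae_pi_mem_Icc hyp.eq_zero hρ N
  have hgm : Measurable fun m : Fin N → ℝ =>
      Real.log ‖Matrix.toEuclideanLin (andersonTransferProd 2 (padSeq (ω' ^ 2 • m)) N) v‖ :=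
    (measurable_norm_chainTransfer_apply ω' N v).log
  have hbound : ∀ᵐ m ∂(Measure.pi fun _ : Fin N => ρ),
      |Real.log ‖Matrix.toEuclideanLin (andersonTransferProd 2 (padSeq (ω' ^ 2 • m)) N) v‖| ≤ B := by
    filter_upwards [hae] with m hm
    exact (abs_log_norm_chainTransfer_apply_le ha hb hm hω'abs hv le_rfl).trans (by rw [hB]; linarith)
  have key := integral_exp_neg_mul_le (Measure.pi fun _ : Fin N => ρ) hgm hB1 hbound hmean
  have hv0 : v ≠ 0 := by
    intro h; rw [h, norm_zero] at hv; exact zero_ne_one hv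
  refine le_of_eq_of_le (integral_congr_ae (ae_of_all _ fun m => ?_)) key
  have hpos := norm_transferProd_apply_pos 2 (padSeq (ω' ^ 2 • m)) N hv0
  simp only
  rw [Real.rpow_def_of_pos hpos]
  congr 1
  ring


/-- **Local block contraction.** For `ω` in the band `[ω₀, Ω]` there are a scale `N`, a radius
`δ > 0` and an exponent `s ∈ (0, 2]` such that `𝔼 ‖Q_N(ω') v‖^{-s} ≤ 1 - s/2` for every unit
vector `v` and every `ω' ∈ [ω₀, Ω]` with `|ω' - ω| < δ` (from `𝔼 log‖Q_N(ω)v‖ ≥ 2`, the Lipschitz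
bound, and `e^{-y} ≤ 1 - y + y²`; in fact `s ≤ 1`). [cite: BucajEtAl2019, Props. 3.4 and 3.6 (the local-uniformity step)] -/
theorem chain_block_contraction (hP : BucajEtAl2019_lyapunovPos) (hV : BucajEtAl2019_vectorLDT)
    {τ : ℝ → ℝ} {a b : ℝ} (hyp : MassDensityHyp τ a b) {ρ : Measure ℝ} [IsProbabilityMeasure ρ]
    (hρ : ρ = volume.withDensity fun s => ENNReal.ofReal (τ s)) {ω₀ Ω ω : ℝ} (hω₀ : 0 < ω₀)
    (hω : ω ∈ Set.Icc ω₀ Ω) :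
    ∃ N : ℕ, 1 ≤ N ∧ ∃ δ : ℝ, 0 < δ ∧ ∃ s : ℝ, 0 < s ∧ s ≤ 1 ∧
      ∀ ω' ∈ Set.Icc ω₀ Ω, |ω' - ω| < δ → ∀ v : EuclideanSpace ℝ (Fin 2), ‖v‖ = 1 →
        ∫ m, ‖Matrix.toEuclideanLin (andersonTransferProd 2 (padSeq (ω' ^ 2 • m)) N) v‖ ^ (-s)
          ∂(Measure.pi fun _ : Fin N => ρ) ≤ 1 - s / 2 :=
  chain_block_contraction_of_core hyp hρ hω₀ hω
    (chain_logMoment_lower hP hV hyp hρ (hω₀.trans_le hω.1) hω.2)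


/-! ### Blocks: exponential decay of the negative moment of the first column, locally uniformly in `ω` -/

/-- Scaling commutes with concatenation of samples. [folklore] -/
theorem smul_fin_append {p q : ℕ} (c : ℝ) (x : Fin p → ℝ) (y : Fin q → ℝ) :
    c • Fin.append x y = Fin.append (c • x) (c • y) := by
  funext i
  refine Fin.addCases (fun j => ?_) (fun j => ?_) i
  · simp [Fin.append_left]
  · simp [Fin.append_right]

/-- Measurability of `m ↦ ‖Q_k(ω, m) v‖^{-s}` as an `ℝ≥0∞`-valued function. [folklore] -/
theorem measurable_ofReal_negMoment {n : ℕ} (ω : ℝ) (k : ℕ) (v : EuclideanSpace ℝ (Fin 2)) (s : ℝ) :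
    Measurable fun m : Fin n → ℝ =>
      ENNReal.ofReal (‖Matrix.toEuclideanLin (andersonTransferProd 2 (padSeq (ω ^ 2 • m)) k) v‖ ^ (-s)) :=
  ((measurable_norm_chainTransfer_apply ω k v).pow_const (-s)).ennreal_ofReal

/-- **Locally uniform exponential decay of `𝔼 ‖Q_n(ω') e₁‖^{-s}` from the pointwise core.**
Given a scale `N` with `𝔼 log‖Q_N(ω) v‖ ≥ 2` for all unit `v` at `ω ∈ [ω₀, Ω]`, there are
`δ, s, C, c > 0` (`s ≤ 1`) with `𝔼 ‖Q_n(ω') e₁‖^{-s} ≤ C e^{-cn}` for all `n` and all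
`ω' ∈ [ω₀, Ω]`, `|ω' - ω| < δ` (block contraction, independence of the blocks, cocycle identity).
[cite: BucajEtAl2019, Prop. 3.6 (proof: the product structure (3.13)-(3.15))] -/
theorem chain_negMoment_decay_local_of_core
    {τ : ℝ → ℝ} {a b : ℝ} (hyp : MassDensityHyp τ a b) {ρ : Measure ℝ} [IsProbabilityMeasure ρ]
    (hρ : ρ = volume.withDensity fun s => ENNReal.ofReal (τ s)) {ω₀ Ω ω : ℝ} (hω₀ : 0 < ω₀)
    (hω : ω ∈ Set.Icc ω₀ Ω)
    (hcore : ∃ N : ℕ, 1 ≤ N ∧ ∀ v : EuclideanSpace ℝ (Fin 2), ‖v‖ = 1 →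
      2 ≤ ∫ m, Real.log ‖Matrix.toEuclideanLin (andersonTransferProd 2 (padSeq (ω ^ 2 • m)) N) v‖
        ∂(Measure.pi fun _ : Fin N => ρ)) :
    ∃ δ : ℝ, 0 < δ ∧ ∃ s : ℝ, 0 < s ∧ s ≤ 1 ∧ ∃ C c : ℝ, 0 < C ∧ 0 < c ∧
      ∀ ω' ∈ Set.Icc ω₀ Ω, |ω' - ω| < δ → ∀ n : ℕ,
        ∫⁻ m, ENNReal.ofReal (‖Matrix.toEuclideanLin (andersonTransferProd 2 (padSeq (ω' ^ 2 • m)) n)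
            (EuclideanSpace.single (0 : Fin 2) (1 : ℝ))‖ ^ (-s)) ∂(Measure.pi fun _ : Fin n => ρ) ≤
          ENNReal.ofReal (C * Real.exp (-(c * n))) := by
  have ha := hyp.pos
  have hb : 0 ≤ b := ha.le.trans hyp.lt.le
  obtain ⟨N, hN1, δ, hδ, s, hs0, hs1, hblock⟩ := chain_block_contraction_of_core hyp hρ hω₀ hω hcore
  set θ : ℝ := 1 - s / 2 with hθ
  have hθ0 : 0 < θ := by rw [hθ]; linarith
  have hθ1 : θ < 1 := by rw [hθ]; linarith
  set K : ℝ := b * Ω ^ 2 + 3 with hK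
  have hK1 : 1 ≤ K := by rw [hK]; nlinarith [mul_nonneg hb (sq_nonneg Ω)]
  set A : ℝ := (K ^ N) ^ s with hA
  have hA0 : 0 ≤ A := by positivity
  have hlogθ : 0 < -Real.log θ := by
    have := Real.log_neg hθ0 hθ1; linarith
  refine ⟨δ, hδ, s, hs0, hs1, A / θ, -Real.log θ / N, by positivity, by positivity, ?_⟩
  intro ω' hω' hdist n
  have hω'pos : 0 < ω' := hω₀.trans_le hω'.1
  have hω'abs : |ω'| ≤ Ω := by rw [abs_of_pos hω'pos]; exact hω'.2
  set e₁ : EuclideanSpace ℝ (Fin 2) := EuclideanSpace.single (0 : Fin 2) (1 : ℝ) with he₁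
  have he₁n : ‖e₁‖ = 1 := by rw [he₁, PiLp.norm_single]; simp
  -- the sequence a
  set aseq : ℕ → ENNReal := fun k => ∫⁻ m, ENNReal.ofReal
      (‖Matrix.toEuclideanLin (andersonTransferProd 2 (padSeq (ω' ^ 2 • m)) k) e₁‖ ^ (-s))
      ∂(Measure.pi fun _ : Fin k => ρ) with haseq
  have hNpos : 1 ≤ N := hN1
  -- initial bound
  have hinit : ∀ k, k < N → aseq k ≤ ENNReal.ofReal A := by
    intro k hk
    have hae : ∀ᵐ m ∂(Measure.pi fun _ : Fin k => ρ), ∀ i, a ≤ m i ∧ m i ≤ b := ae_pi_mem_Icc hyp.eq_zero hρ k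
    calc aseq k ≤ ∫⁻ _m, ENNReal.ofReal A ∂(Measure.pi fun _ : Fin k => ρ) := by
          refine lintegral_mono_ae ?_
          filter_upwards [hae] with m hm
          apply ENNReal.ofReal_le_ofReal
          obtain ⟨-, h2⟩ := norm_chainTransfer_apply_bounds ha hb hm hω'abs e₁ (le_refl k)
          rw [he₁n] at h2
          set R := ‖Matrix.toEuclideanLin (andersonTransferProd 2 (padSeq (ω' ^ 2 • m)) k) e₁‖
          have hKk : 0 < K ^ k := by positivity
          have hRpos : 0 < R := by
            calc (0:ℝ) < (K ^ k)⁻¹ * 1 := by positivity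
              _ ≤ (K ^ k)⁻¹ * (K ^ k * R) := by gcongr
              _ = R := by field_simp
          have hR : (K ^ k)⁻¹ ≤ R := by rw [inv_le_iff_one_le_mul₀' hKk]; exact h2
          calc R ^ (-s) ≤ ((K ^ k)⁻¹) ^ (-s) :=
                Real.rpow_le_rpow_of_nonpos (by positivity) hR (by linarith)
            _ = (K ^ k) ^ s := by rw [Real.inv_rpow (by positivity), ← Real.rpow_neg (by positivity), neg_neg]
            _ ≤ (K ^ N) ^ s := by
                apply Real.rpow_le_rpow (by positivity) _ hs0.le
                exact pow_le_pow_right₀ hK1 hk.le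
      _ = ENNReal.ofReal A := by simp
  -- the block step
  have hstep : ∀ k, aseq (k + N) ≤ ENNReal.ofReal θ * aseq k := by
    intro k
    simp only [haseq]
    have hF : Measurable fun z : Fin (k + N) → ℝ => ENNReal.ofReal
        (‖Matrix.toEuclideanLin (andersonTransferProd 2 (padSeq (ω' ^ 2 • z)) (k + N)) e₁‖ ^ (-s)) :=
      measurable_ofReal_negMoment ω' (k + N) e₁ s
    rw [lintegral_pi_fin_add ρ k N hF]
    -- rewrite the integrand over the appended sample
    have hsplit : ∀ (x : Fin k → ℝ) (y : Fin N → ℝ),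
        ENNReal.ofReal (‖Matrix.toEuclideanLin (andersonTransferProd 2 (padSeq (ω' ^ 2 • Fin.append x y)) (k + N)) e₁‖ ^ (-s)) =
        ENNReal.ofReal (‖Matrix.toEuclideanLin (andersonTransferProd 2 (padSeq (ω' ^ 2 • x)) k) e₁‖ ^ (-s)) *
          ENNReal.ofReal (‖Matrix.toEuclideanLin (andersonTransferProd 2 (padSeq (ω' ^ 2 • y)) N)
            (‖Matrix.toEuclideanLin (andersonTransferProd 2 (padSeq (ω' ^ 2 • x)) k) e₁‖⁻¹ •
              Matrix.toEuclideanLin (andersonTransferProd 2 (padSeq (ω' ^ 2 • x)) k) e₁)‖ ^ (-s)) := by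
      intro x y
      rw [smul_fin_append, andersonTransferProd_append, toEuclideanLin_mul_apply]
      set w := Matrix.toEuclideanLin (andersonTransferProd 2 (padSeq (ω' ^ 2 • x)) k) e₁ with hw
      set Mq := andersonTransferProd 2 (padSeq (ω' ^ 2 • y)) N
      have hw0 : w ≠ 0 := by
        have := norm_transferProd_apply_pos 2 (padSeq (ω' ^ 2 • x)) k
          (v := e₁) (by intro h; rw [h, norm_zero] at he₁n; exact zero_ne_one he₁n)
        exact norm_pos_iff.mp this
      have hwn : 0 < ‖w‖ := norm_pos_iff.mpr hw0
      have hdecomp : Matrix.toEuclideanLin Mq w = ‖w‖ • Matrix.toEuclideanLin Mq (‖w‖⁻¹ • w) := by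
        rw [map_smul, smul_smul, mul_inv_cancel₀ hwn.ne', one_smul]
      rw [hdecomp, norm_smul, Real.norm_of_nonneg hwn.le,
        Real.mul_rpow hwn.le (norm_nonneg _), ENNReal.ofReal_mul (Real.rpow_nonneg hwn.le _)]
    simp_rw [hsplit]
    -- integrate in y first: ≤ ofReal θ
    have hinner : ∀ x : Fin k → ℝ,
        ∫⁻ y, ENNReal.ofReal (‖Matrix.toEuclideanLin (andersonTransferProd 2 (padSeq (ω' ^ 2 • y)) N)
            (‖Matrix.toEuclideanLin (andersonTransferProd 2 (padSeq (ω' ^ 2 • x)) k) e₁‖⁻¹ •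
              Matrix.toEuclideanLin (andersonTransferProd 2 (padSeq (ω' ^ 2 • x)) k) e₁)‖ ^ (-s))
          ∂(Measure.pi fun _ : Fin N => ρ) ≤ ENNReal.ofReal θ := by
      intro x
      set w := Matrix.toEuclideanLin (andersonTransferProd 2 (padSeq (ω' ^ 2 • x)) k) e₁ with hw
      have hw0 : w ≠ 0 := by
        have := norm_transferProd_apply_pos 2 (padSeq (ω' ^ 2 • x)) k
          (v := e₁) (by intro h; rw [h, norm_zero] at he₁n; exact zero_ne_one he₁n)
        exact norm_pos_iff.mp this
      have hwn : 0 < ‖w‖ := norm_pos_iff.mpr hw0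
      set u : EuclideanSpace ℝ (Fin 2) := ‖w‖⁻¹ • w with hu
      have hun : ‖u‖ = 1 := by
        rw [hu, norm_smul, norm_inv, norm_norm, inv_mul_cancel₀ hwn.ne']
      -- integrability of the real integrand
      have hae : ∀ᵐ y ∂(Measure.pi fun _ : Fin N => ρ), ∀ i, a ≤ y i ∧ y i ≤ b :=
        ae_pi_mem_Icc hyp.eq_zero hρ N
      have hmeas : Measurable fun y : Fin N → ℝ =>
          ‖Matrix.toEuclideanLin (andersonTransferProd 2 (padSeq (ω' ^ 2 • y)) N) u‖ ^ (-s) :=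
        (measurable_norm_chainTransfer_apply ω' N u).pow_const (-s)
      have hnn : 0 ≤ᵐ[Measure.pi fun _ : Fin N => ρ] fun y : Fin N → ℝ =>
          ‖Matrix.toEuclideanLin (andersonTransferProd 2 (padSeq (ω' ^ 2 • y)) N) u‖ ^ (-s) :=
        ae_of_all _ fun y => Real.rpow_nonneg (norm_nonneg _) _
      have hint : Integrable (fun y : Fin N → ℝ =>
          ‖Matrix.toEuclideanLin (andersonTransferProd 2 (padSeq (ω' ^ 2 • y)) N) u‖ ^ (-s))
          (Measure.pi fun _ : Fin N => ρ) := by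
        refine Integrable.of_bound hmeas.aestronglyMeasurable ((K ^ N) ^ s) ?_
        filter_upwards [hae] with y hy
        obtain ⟨-, h2⟩ := norm_chainTransfer_apply_bounds ha hb hy hω'abs u (le_refl N)
        rw [hun] at h2
        set R := ‖Matrix.toEuclideanLin (andersonTransferProd 2 (padSeq (ω' ^ 2 • y)) N) u‖
        have hKN : 0 < K ^ N := by positivity
        have hRpos : 0 < R := by
          calc (0:ℝ) < (K ^ N)⁻¹ * 1 := by positivity
            _ ≤ (K ^ N)⁻¹ * (K ^ N * R) := by gcongr
            _ = R := by field_simp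
        have hR : (K ^ N)⁻¹ ≤ R := by rw [inv_le_iff_one_le_mul₀' hKN]; exact h2
        rw [Real.norm_of_nonneg (Real.rpow_nonneg hRpos.le _)]
        calc R ^ (-s) ≤ ((K ^ N)⁻¹) ^ (-s) :=
              Real.rpow_le_rpow_of_nonpos (by positivity) hR (by linarith)
          _ = (K ^ N) ^ s := by rw [Real.inv_rpow (by positivity), ← Real.rpow_neg (by positivity), neg_neg]
      rw [← ofReal_integral_eq_lintegral_ofReal hint hnn]
      exact ENNReal.ofReal_le_ofReal (hblock ω' hω' hdist u hun)
    calc ∫⁻ x, ∫⁻ y, ENNReal.ofReal (‖Matrix.toEuclideanLin (andersonTransferProd 2 (padSeq (ω' ^ 2 • x)) k) e₁‖ ^ (-s)) *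
            ENNReal.ofReal (‖Matrix.toEuclideanLin (andersonTransferProd 2 (padSeq (ω' ^ 2 • y)) N)
              (‖Matrix.toEuclideanLin (andersonTransferProd 2 (padSeq (ω' ^ 2 • x)) k) e₁‖⁻¹ •
                Matrix.toEuclideanLin (andersonTransferProd 2 (padSeq (ω' ^ 2 • x)) k) e₁)‖ ^ (-s))
            ∂(Measure.pi fun _ : Fin N => ρ) ∂(Measure.pi fun _ : Fin k => ρ)
        = ∫⁻ x, ENNReal.ofReal (‖Matrix.toEuclideanLin (andersonTransferProd 2 (padSeq (ω' ^ 2 • x)) k) e₁‖ ^ (-s)) *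
            ∫⁻ y, ENNReal.ofReal (‖Matrix.toEuclideanLin (andersonTransferProd 2 (padSeq (ω' ^ 2 • y)) N)
              (‖Matrix.toEuclideanLin (andersonTransferProd 2 (padSeq (ω' ^ 2 • x)) k) e₁‖⁻¹ •
                Matrix.toEuclideanLin (andersonTransferProd 2 (padSeq (ω' ^ 2 • x)) k) e₁)‖ ^ (-s))
            ∂(Measure.pi fun _ : Fin N => ρ) ∂(Measure.pi fun _ : Fin k => ρ) := by
          refine lintegral_congr fun x => ?_
          rw [lintegral_const_mul]
          exact measurable_ofReal_negMoment ω' N _ s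
      _ ≤ ∫⁻ x, ENNReal.ofReal (‖Matrix.toEuclideanLin (andersonTransferProd 2 (padSeq (ω' ^ 2 • x)) k) e₁‖ ^ (-s)) *
            ENNReal.ofReal θ ∂(Measure.pi fun _ : Fin k => ρ) := by
          refine lintegral_mono fun x => ?_
          gcongr
          exact hinner x
      _ = ENNReal.ofReal θ * ∫⁻ x, ENNReal.ofReal
            (‖Matrix.toEuclideanLin (andersonTransferProd 2 (padSeq (ω' ^ 2 • x)) k) e₁‖ ^ (-s))
            ∂(Measure.pi fun _ : Fin k => ρ) := by
          rw [lintegral_mul_const _ (measurable_ofReal_negMoment ω' k e₁ s), mul_comm]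
  have := decay_of_block_contraction hNpos hθ0 hθ1 hA0 hstep hinit n
  simpa [haseq] using this


/-- **Locally uniform exponential decay of `𝔼 ‖Q_n(ω') e₁‖^{-s}`.** For `ω` in the band
`[ω₀, Ω]` there are `δ, s, C, c > 0` (`s ≤ 1`) with
`𝔼 ‖Q_n(ω') e₁‖^{-s} ≤ C e^{-cn}` for all `n` and all `ω' ∈ [ω₀, Ω]`, `|ω' - ω| < δ`: the block
contraction `𝔼‖Q_N v‖^{-s} ≤ θ := 1 - s/2` for all unit `v`, independence of the blocks
(`Q_{n+N} = Q'_N Q_n`, `‖Q'_N Q_n e₁‖^{-s} = ‖Q_n e₁‖^{-s} ‖Q'_N u‖^{-s}`, `u` the direction of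
`Q_n e₁`) and `𝔼‖Q_r e₁‖^{-s} ≤ K^{sN}` for `r < N` give `𝔼‖Q_n e₁‖^{-s} ≤ K^{sN} θ^{⌊n/N⌋}`.
[cite: BucajEtAl2019, Prop. 3.6 (proof: the product structure (3.13)-(3.15))] -/
theorem chain_negMoment_decay_local (hP : BucajEtAl2019_lyapunovPos) (hV : BucajEtAl2019_vectorLDT)
    {τ : ℝ → ℝ} {a b : ℝ} (hyp : MassDensityHyp τ a b) {ρ : Measure ℝ} [IsProbabilityMeasure ρ]
    (hρ : ρ = volume.withDensity fun s => ENNReal.ofReal (τ s)) {ω₀ Ω ω : ℝ} (hω₀ : 0 < ω₀)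
    (hω : ω ∈ Set.Icc ω₀ Ω) :
    ∃ δ : ℝ, 0 < δ ∧ ∃ s : ℝ, 0 < s ∧ s ≤ 1 ∧ ∃ C c : ℝ, 0 < C ∧ 0 < c ∧
      ∀ ω' ∈ Set.Icc ω₀ Ω, |ω' - ω| < δ → ∀ n : ℕ,
        ∫⁻ m, ENNReal.ofReal (‖Matrix.toEuclideanLin (andersonTransferProd 2 (padSeq (ω' ^ 2 • m)) n)
            (EuclideanSpace.single (0 : Fin 2) (1 : ℝ))‖ ^ (-s)) ∂(Measure.pi fun _ : Fin n => ρ) ≤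
          ENNReal.ofReal (C * Real.exp (-(c * n))) :=
  chain_negMoment_decay_local_of_core hyp hρ hω₀ hω
    (chain_logMoment_lower hP hV hyp hρ (hω₀.trans_le hω.1) hω.2)


/-! ### Compactness of the band: uniform exponential decay of `𝔼 j_n(ω)` on `[ω₀, Ω]` -/

/-- **Exponential decay of `𝔼 j_n(ω)` on a compact frequency band from the pointwise core.**
If at every `ω ∈ [ω₀, Ω]` (`0 < ω₀`) there is a scale `N` with `𝔼 log‖Q_N(ω) v‖ ≥ 2` for all unit
`v`, then there are `C, c > 0` with `𝔼 j_n(ω) ≤ C e^{-cn}` for all `n ≥ 1` and all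
`ω ∈ [ω₀, Ω]` (band comparison `j_n ≤ K₀‖Q_n e₁‖^{-s}`, locally uniform decay, finite subcover).
[cite: AjankiHuveneers2011, §2 ¶3 and §6.2 (the term `𝒥₃`)] [cite: BucajEtAl2019, Prop. 3.6 (proof structure)] -/
theorem clAvgCurrentDensity_band_decay_of_core
    {τ : ℝ → ℝ} {a b : ℝ} (hyp : MassDensityHyp τ a b) {ρ : Measure ℝ} [IsProbabilityMeasure ρ]
    (hρ : ρ = volume.withDensity fun s => ENNReal.ofReal (τ s)) {ω₀ Ω : ℝ} (hω₀ : 0 < ω₀) (hΩ : ω₀ ≤ Ω)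
    (hcore : ∀ ω ∈ Set.Icc ω₀ Ω, ∃ N : ℕ, 1 ≤ N ∧ ∀ v : EuclideanSpace ℝ (Fin 2), ‖v‖ = 1 →
      2 ≤ ∫ m, Real.log ‖Matrix.toEuclideanLin (andersonTransferProd 2 (padSeq (ω ^ 2 • m)) N) v‖
        ∂(Measure.pi fun _ : Fin N => ρ)) :
    ∃ C c : ℝ, 0 < C ∧ 0 < c ∧ ∀ ω ∈ Set.Icc ω₀ Ω, ∀ n : ℕ, 1 ≤ n →
      clAvgCurrentDensity ρ n ω ≤ C * Real.exp (-(c * n)) := by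
  set I : Set ℝ := Set.Icc ω₀ Ω with hI
  have H : ∀ ω ∈ I, ∃ δ s C c : ℝ, 0 < δ ∧ 0 < s ∧ s ≤ 1 ∧ 0 < C ∧ 0 < c ∧
      ∀ ω' ∈ I, |ω' - ω| < δ → ∀ n : ℕ,
        ∫⁻ m, ENNReal.ofReal (‖Matrix.toEuclideanLin (andersonTransferProd 2 (padSeq (ω' ^ 2 • m)) n)
            (EuclideanSpace.single (0 : Fin 2) (1 : ℝ))‖ ^ (-s)) ∂(Measure.pi fun _ : Fin n => ρ) ≤
          ENNReal.ofReal (C * Real.exp (-(c * n))) := by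
    intro ω hω
    obtain ⟨δ, hδ, s, hs0, hs1, C, c, hC, hc, h⟩ :=
      chain_negMoment_decay_local_of_core hyp hρ hω₀ hω (hcore ω hω)
    exact ⟨δ, s, C, c, hδ, hs0, hs1, hC, hc, h⟩
  choose! δ s C c hδ hs0 hs1 hC hc hdec using H
  -- finite subcover of the compact band
  have hcover : I ⊆ ⋃ i : I, Metric.ball (i : ℝ) (δ i) := by
    intro x hx
    refine Set.mem_iUnion.mpr ⟨⟨x, hx⟩, ?_⟩
    exact Metric.mem_ball_self (hδ x hx)
  obtain ⟨t, ht⟩ := isCompact_Icc.elim_finite_subcover (fun i : I => Metric.ball (i : ℝ) (δ i))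
    (fun _ => Metric.isOpen_ball) hcover
  have hω₀I : ω₀ ∈ I := ⟨le_rfl, hΩ⟩
  have htne : t.Nonempty := by
    have := ht hω₀I
    simp only [Set.mem_iUnion] at this
    obtain ⟨i, hi, -⟩ := this
    exact ⟨i, hi⟩
  set K₀ : ℝ := max (1 / 2) (Ω ^ 2 / min 1 (ω₀ ^ 2)) with hK₀
  have hK₀pos : 0 < K₀ := lt_of_lt_of_le (by norm_num) (le_max_left _ _)
  set Cbig : ℝ := K₀ * ∑ i ∈ t, C i with hCbig
  set cmin : ℝ := t.inf' htne fun i => c i with hcmin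
  have hCsum_pos : 0 < ∑ i ∈ t, C i :=
    Finset.sum_pos (fun i _ => hC i i.2) htne
  have hcmin_pos : 0 < cmin := by
    rw [hcmin, Finset.lt_inf'_iff]
    exact fun i _ => hc i i.2
  refine ⟨Cbig, cmin, by positivity, hcmin_pos, fun ω hω n hn => ?_⟩
  -- pick the ball containing ω
  have hωcov := ht hω
  simp only [Set.mem_iUnion] at hωcov
  obtain ⟨i, hit, hωi⟩ := hωcov
  rw [Metric.mem_ball, Real.dist_eq] at hωi
  have hiI : (i : ℝ) ∈ I := i.2
  obtain ⟨k, rfl⟩ : ∃ k, n = k + 1 := ⟨n - 1, by omega⟩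
  -- pointwise band comparison and integration
  set P : Measure (Fin (k + 1) → ℝ) := Measure.pi fun _ : Fin (k + 1) => ρ
  set g : (Fin (k + 1) → ℝ) → ℝ := fun m =>
    ‖Matrix.toEuclideanLin (andersonTransferProd 2 (padSeq (ω ^ 2 • m)) (k + 1))
      (EuclideanSpace.single (0 : Fin 2) (1 : ℝ))‖ ^ (-(s i)) with hg
  have hgm : Measurable g := (measurable_norm_chainTransfer_apply ω (k + 1) _).pow_const _
  have hgnn : 0 ≤ᵐ[P] g := ae_of_all _ fun m => Real.rpow_nonneg (norm_nonneg _) _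
  have hlint := hdec i hiI ω hω hωi (k + 1)
  have hlint_ne_top : ∫⁻ m, ENNReal.ofReal (g m) ∂P ≠ ⊤ := ne_top_of_le_ne_top ENNReal.ofReal_ne_top hlint
  have hgi : Integrable g P := (lintegral_ofReal_ne_top_iff_integrable hgm.aestronglyMeasurable hgnn).mp hlint_ne_top
  have hint_g : ∫ m, g m ∂P ≤ C i * Real.exp (-(c i * (k + 1 : ℕ))) := by
    rw [integral_eq_lintegral_of_nonneg_ae hgnn hgm.aestronglyMeasurable]
    exact ENNReal.toReal_le_of_le_ofReal (mul_pos (hC i hiI) (Real.exp_pos _)).le hlint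
  have hpt : ∀ m, clCurrentDensity m ω ≤ K₀ * g m := fun m =>
    clCurrentDensity_band_bound m hω₀ hω.1 hω.2 (hs0 i hiI) ((hs1 i hiI).trans (by norm_num))
  calc clAvgCurrentDensity ρ (k + 1) ω = ∫ m, clCurrentDensity m ω ∂P := rfl
    _ ≤ ∫ m, K₀ * g m ∂P :=
        integral_mono (integrable_clCurrentDensity_left ρ (k + 1) ω) (hgi.const_mul K₀) hpt
    _ = K₀ * ∫ m, g m ∂P := integral_const_mul _ _
    _ ≤ K₀ * (C i * Real.exp (-(c i * (k + 1 : ℕ)))) := by gcongr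
    _ ≤ Cbig * Real.exp (-(cmin * (k + 1 : ℕ))) := by
        rw [hCbig, mul_assoc]
        apply mul_le_mul_of_nonneg_left _ hK₀pos.le
        apply mul_le_mul
        · exact Finset.single_le_sum (f := fun j : I => C (j : ℝ)) (fun j _ => (hC j j.2).le) hit
        · apply Real.exp_le_exp.mpr
          have : cmin ≤ c i := Finset.inf'_le _ hit
          have : (0 : ℝ) ≤ (k + 1 : ℕ) := by positivity
          nlinarith
        · positivity
        · exact hCsum_pos.le


/-- **Exponential decay of the mass-averaged current density on a compact frequency band.**
Under Fürstenberg positivity and the vectorwise uniform LDT for the Anderson model (Bucaj et al.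
Thm 2.3, Prop. 3.6), for `0 < ω₀ ≤ Ω` there are `C, c > 0` with `𝔼 j_n(ω) ≤ C e^{-cn}` for all
`n ≥ 1` and all `ω ∈ [ω₀, Ω]`: the band comparison `j_n ≤ K₀‖Q_n e₁‖^{-s}`, the locally uniform
decay of `𝔼‖Q_n e₁‖^{-s}`, and a finite subcover of `[ω₀, Ω]`. This is the `ω ∈ [w₀, Ω]` part of
the high-frequency estimate that AH2011 take from O'Connor (with the rate `e^{-cn}`).
[cite: AjankiHuveneers2011, §2 ¶3 and §6.2 (the term `𝒥₃`)] [cite: BucajEtAl2019, Thm 2.3 and Prop. 3.6] -/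
theorem clAvgCurrentDensity_band_decay (hP : BucajEtAl2019_lyapunovPos) (hV : BucajEtAl2019_vectorLDT)
    {τ : ℝ → ℝ} {a b : ℝ} (hyp : MassDensityHyp τ a b) {ρ : Measure ℝ} [IsProbabilityMeasure ρ]
    (hρ : ρ = volume.withDensity fun s => ENNReal.ofReal (τ s)) {ω₀ Ω : ℝ} (hω₀ : 0 < ω₀) (hΩ : ω₀ ≤ Ω) :
    ∃ C c : ℝ, 0 < C ∧ 0 < c ∧ ∀ ω ∈ Set.Icc ω₀ Ω, ∀ n : ℕ, 1 ≤ n →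
      clAvgCurrentDensity ρ n ω ≤ C * Real.exp (-(c * n)) :=
  clAvgCurrentDensity_band_decay_of_core hyp hρ hω₀ hΩ fun _ω hω =>
    chain_logMoment_lower hP hV hyp hρ (hω₀.trans_le hω.1) hω.2


/-! ### Assembly of the high-frequency bound (H) -/

/-- The averaged ultraviolet bound: for `aω² ≥ 5`, `𝔼 j_n(ω) ≤ (25/(4a²)) ω⁻² 4^{-(n-1)}`.
[cite: AjankiHuveneers2011, §6.2 (the term `𝒥₃`)] -/
theorem clAvgCurrentDensity_uv_bound {τ : ℝ → ℝ} {a b : ℝ} (hyp : MassDensityHyp τ a b)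
    {ρ : Measure ℝ} [IsProbabilityMeasure ρ] (hρ : ρ = volume.withDensity fun s => ENNReal.ofReal (τ s))
    {ω : ℝ} (hω : 5 ≤ a * ω ^ 2) (k : ℕ) :
    clAvgCurrentDensity ρ (k + 1) ω ≤ 25 / (4 * a ^ 2) * (ω ^ 2)⁻¹ * (4 ^ k)⁻¹ := by
  have hae : ∀ᵐ m ∂(Measure.pi fun _ : Fin (k + 1) => ρ), ∀ i, a ≤ m i ∧ m i ≤ b :=
    ae_pi_mem_Icc hyp.eq_zero hρ (k + 1)
  calc clAvgCurrentDensity ρ (k + 1) ω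
      ≤ ∫ _m, 25 / (4 * a ^ 2) * (ω ^ 2)⁻¹ * (4 ^ k)⁻¹ ∂(Measure.pi fun _ : Fin (k + 1) => ρ) := by
        refine integral_mono_ae (integrable_clCurrentDensity_left ρ (k + 1) ω) (integrable_const _) ?_
        filter_upwards [hae] with m hm
        exact clCurrentDensity_uv_bound hyp.pos (fun i => (hm i).1) hω
    _ = 25 / (4 * a ^ 2) * (ω ^ 2)⁻¹ * (4 ^ k)⁻¹ := by simp

/-- **(H) from the pointwise core.** If for every admissible mass density, every frequency
`ω > 0` has a scale `N` with `𝔼 log‖Q_N(ω) v‖ ≥ 2` for all unit `v`, then the high-frequency bound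
`∫_{ω₀}^∞ 𝔼 j_n ≤ C e^{-c√n}` of the Ajanki–Huveneers decomposition holds (rate `e^{-cn}`):
`[ω₀, Ω]` by `clAvgCurrentDensity_band_decay_of_core`, `[Ω, ∞)`, `Ω = max(ω₀, √(5/a))`, by the
deterministic ultraviolet bound. [cite: AjankiHuveneers2011, §2 ¶3 and §6.2 (the term `𝒥₃`)] -/
theorem AjankiHuveneers2011_highFrequencyBound_of_core
    (hcore : ∀ (τ : ℝ → ℝ) (a b : ℝ), MassDensityHyp τ a b →
      ∀ (ρ : Measure ℝ) [IsProbabilityMeasure ρ],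
        ρ = volume.withDensity (fun s => ENNReal.ofReal (τ s)) →
        ∀ ω : ℝ, 0 < ω → ∃ N : ℕ, 1 ≤ N ∧ ∀ v : EuclideanSpace ℝ (Fin 2), ‖v‖ = 1 →
          2 ≤ ∫ m, Real.log ‖Matrix.toEuclideanLin (andersonTransferProd 2 (padSeq (ω ^ 2 • m)) N) v‖
            ∂(Measure.pi fun _ : Fin N => ρ)) :
    AjankiHuveneers2011_highFrequencyBound := by
  intro τ a b hyp ρ _ hρ ω₀ hω₀
  have ha := hyp.pos
  set Ω : ℝ := max ω₀ (Real.sqrt (5 / a)) with hΩdef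
  have hΩ : ω₀ ≤ Ω := le_max_left _ _
  have hΩpos : 0 < Ω := hω₀.trans_le hΩ
  have hΩuv : ∀ ω, Ω ≤ ω → 5 ≤ a * ω ^ 2 := by
    intro ω hω
    have h1 : Real.sqrt (5 / a) ≤ ω := (le_max_right _ _).trans hω
    have h2 : (Real.sqrt (5 / a)) ^ 2 = 5 / a := Real.sq_sqrt (by positivity)
    have h3 : 5 / a ≤ ω ^ 2 := by
      rw [← h2]; exact pow_le_pow_left₀ (Real.sqrt_nonneg _) h1 2
    calc (5 : ℝ) = a * (5 / a) := by field_simp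
      _ ≤ a * ω ^ 2 := by gcongr
  obtain ⟨C, c, hC, hc, hband⟩ := clAvgCurrentDensity_band_decay_of_core hyp hρ hω₀ hΩ
    fun ω hω => hcore τ a b hyp ρ hρ ω (hω₀.trans_le hω.1)
  set Kuv : ℝ := 25 / (4 * a ^ 2) with hKuv
  set c' : ℝ := min c (Real.log 4) with hc'
  have hlog4 : 0 < Real.log 4 := Real.log_pos (by norm_num)
  have hc'pos : 0 < c' := lt_min hc hlog4
  refine ⟨C * (Ω - ω₀) + 4 * Kuv / Ω, c', hc'pos, fun n hn => ?_⟩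
  obtain ⟨k, rfl⟩ : ∃ k, n = k + 1 := ⟨n - 1, by omega⟩
  set f := clAvgCurrentDensity ρ (k + 1) with hf
  -- integrability on (Ω, ∞) by domination with ω⁻²
  have hmeas : AEStronglyMeasurable f (volume.restrict (Set.Ioi Ω)) :=
    (stronglyMeasurable_clAvgCurrentDensity ρ (k + 1)).aestronglyMeasurable
  have hdom_int : IntegrableOn (fun ω : ℝ => Kuv * (4 ^ k)⁻¹ * ω ^ (-2 : ℝ)) (Set.Ioi Ω) :=
    (integrableOn_Ioi_rpow_of_lt (by norm_num) hΩpos).const_mul _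
  have hbound_Ioi : ∀ ω ∈ Set.Ioi Ω, f ω ≤ Kuv * (4 ^ k)⁻¹ * ω ^ (-2 : ℝ) := by
    intro ω hω
    have hωpos : 0 < ω := hΩpos.trans hω
    have := clAvgCurrentDensity_uv_bound hyp hρ (hΩuv ω hω.le) k
    rw [hf]
    calc clAvgCurrentDensity ρ (k + 1) ω ≤ 25 / (4 * a ^ 2) * (ω ^ 2)⁻¹ * (4 ^ k)⁻¹ := this
      _ = Kuv * (4 ^ k)⁻¹ * ω ^ (-2 : ℝ) := by
        rw [hKuv, Real.rpow_neg hωpos.le, Real.rpow_two]; ring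
  have hint_Ioi : IntegrableOn f (Set.Ioi Ω) := by
    refine Integrable.mono' hdom_int hmeas ?_
    rw [ae_restrict_iff' measurableSet_Ioi]
    refine ae_of_all _ fun ω hω => ?_
    rw [Real.norm_eq_abs, abs_of_nonneg (clAvgCurrentDensity_nonneg ρ _ ω)]
    exact hbound_Ioi ω hω
  have hfin : volume (Set.Ioc ω₀ Ω) ≠ ⊤ := by rw [Real.volume_Ioc]; exact ENNReal.ofReal_ne_top
  have hint_Ioc : IntegrableOn f (Set.Ioc ω₀ Ω) := integrableOn_clAvgCurrentDensity ρ (k + 1) hfin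
  have hunion : Set.Ioc ω₀ Ω ∪ Set.Ioi Ω = Set.Ioi ω₀ := Set.Ioc_union_Ioi_eq_Ioi hΩ
  have hint : IntegrableOn f (Set.Ioi ω₀) := by
    rw [← hunion]; exact hint_Ioc.union hint_Ioi
  refine ⟨hint, ?_⟩
  -- the two pieces
  have h1 : ∫ ω in Set.Ioc ω₀ Ω, f ω ≤ C * Real.exp (-(c * (k + 1 : ℕ))) * (Ω - ω₀) := by
    have hle : ∀ ω ∈ Set.Ioc ω₀ Ω, f ω ≤ C * Real.exp (-(c * (k + 1 : ℕ))) := fun ω hω =>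
      hband ω ⟨hω.1.le, hω.2⟩ (k + 1) (by omega)
    calc ∫ ω in Set.Ioc ω₀ Ω, f ω ≤ ∫ _ω in Set.Ioc ω₀ Ω, C * Real.exp (-(c * (k + 1 : ℕ))) :=
          setIntegral_mono_on hint_Ioc (integrableOn_const hfin) measurableSet_Ioc hle
      _ = C * Real.exp (-(c * (k + 1 : ℕ))) * (Ω - ω₀) := by
          rw [setIntegral_const, Real.volume_real_Ioc_of_le hΩ, smul_eq_mul, mul_comm]
  have h2 : ∫ ω in Set.Ioi Ω, f ω ≤ Kuv * (4 ^ k)⁻¹ * Ω⁻¹ := by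
    calc ∫ ω in Set.Ioi Ω, f ω ≤ ∫ ω in Set.Ioi Ω, Kuv * (4 ^ k)⁻¹ * ω ^ (-2 : ℝ) :=
          setIntegral_mono_on hint_Ioi hdom_int measurableSet_Ioi hbound_Ioi
      _ = Kuv * (4 ^ k)⁻¹ * ∫ ω in Set.Ioi Ω, ω ^ (-2 : ℝ) := integral_const_mul _ _
      _ = Kuv * (4 ^ k)⁻¹ * Ω⁻¹ := by
          rw [integral_Ioi_rpow_of_lt (by norm_num) hΩpos, show (-2 : ℝ) + 1 = -1 by norm_num,
            Real.rpow_neg_one]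
          ring
  -- combine
  rw [← hunion, setIntegral_union (Set.Ioc_disjoint_Ioi le_rfl) measurableSet_Ioi hint_Ioc hint_Ioi]
  have hn0 : (0 : ℝ) ≤ (k + 1 : ℕ) := by positivity
  have hsq : Real.sqrt ((k + 1 : ℕ) : ℝ) ≤ (k + 1 : ℕ) := by
    rw [Real.sqrt_le_left (by positivity)]
    have h1 : (1 : ℝ) ≤ (k + 1 : ℕ) := by exact_mod_cast Nat.succ_pos k
    nlinarith
  have hsq0 := Real.sqrt_nonneg ((k + 1 : ℕ) : ℝ)
  have hexp1 : Real.exp (-(c * (k + 1 : ℕ))) ≤ Real.exp (-(c' * Real.sqrt (k + 1 : ℕ))) := by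
    apply Real.exp_le_exp.mpr
    have hc'c : c' ≤ c := min_le_left _ _
    have : c' * Real.sqrt (k + 1 : ℕ) ≤ c * (k + 1 : ℕ) :=
      calc c' * Real.sqrt (k + 1 : ℕ) ≤ c * Real.sqrt (k + 1 : ℕ) := mul_le_mul_of_nonneg_right hc'c hsq0
        _ ≤ c * (k + 1 : ℕ) := mul_le_mul_of_nonneg_left hsq hc.le
    linarith
  have hexp2 : (4 ^ k : ℝ)⁻¹ ≤ 4 * Real.exp (-(c' * Real.sqrt (k + 1 : ℕ))) := by
    have e4 : (4 ^ k : ℝ)⁻¹ = 4 * Real.exp (-(Real.log 4 * (k + 1 : ℕ))) := by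
      rw [Real.exp_neg, mul_comm (Real.log 4), Real.exp_nat_mul, Real.exp_log (by norm_num), pow_succ]
      field_simp
    rw [e4]
    apply mul_le_mul_of_nonneg_left _ (by norm_num : (0 : ℝ) ≤ 4)
    apply Real.exp_le_exp.mpr
    have hc'4 : c' ≤ Real.log 4 := min_le_right _ _
    have : c' * Real.sqrt (k + 1 : ℕ) ≤ Real.log 4 * (k + 1 : ℕ) :=
      calc c' * Real.sqrt (k + 1 : ℕ) ≤ Real.log 4 * Real.sqrt (k + 1 : ℕ) := mul_le_mul_of_nonneg_right hc'4 hsq0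
        _ ≤ Real.log 4 * (k + 1 : ℕ) := mul_le_mul_of_nonneg_left hsq hlog4.le
    linarith
  have hΩω₀ : 0 ≤ Ω - ω₀ := by linarith
  calc (∫ ω in Set.Ioc ω₀ Ω, f ω) + ∫ ω in Set.Ioi Ω, f ω
      ≤ C * Real.exp (-(c * (k + 1 : ℕ))) * (Ω - ω₀) + Kuv * (4 ^ k)⁻¹ * Ω⁻¹ := add_le_add h1 h2
    _ ≤ C * Real.exp (-(c' * Real.sqrt (k + 1 : ℕ))) * (Ω - ω₀) +
        Kuv * (4 * Real.exp (-(c' * Real.sqrt (k + 1 : ℕ)))) * Ω⁻¹ := by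
        gcongr
    _ = (C * (Ω - ω₀) + 4 * Kuv / Ω) * Real.exp (-(c' * Real.sqrt (k + 1 : ℕ))) := by ring

/-- **(H) from the Anderson-model facts.** Fürstenberg positivity of the Lyapunov exponent and
the vectorwise uniform large-deviation theorem for the one-dimensional Anderson model
(Bucaj–Damanik–Fillman–Gerbuz–VandenBoom–Wang–Zhang 2019, Thm 2.3 and Prop. 3.6, applied at
energy `E = 2` to the law of the potentials `ω² m_k`) imply the high-frequency bound
`∫_{ω₀}^∞ 𝔼 j_n ≤ C e^{-c√n}` of the Ajanki–Huveneers decomposition — in fact with the rate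
`e^{-cn}`: on `[ω₀, Ω]` by `clAvgCurrentDensity_band_decay`, on `[Ω, ∞)`, `Ω = max(ω₀, √(5/a))`, by
the deterministic ultraviolet bound `𝔼 j_n(ω) ≤ (25/(4a²)) ω⁻² 4^{-(n-1)}`. This replaces the
appeal to O'Connor (CMP 45 (1975), Thm 6) in AH2011 §6.2 by two textbook facts.
[cite: AjankiHuveneers2011, §2 ¶3 and §6.2 (the term `𝒥₃`)] [cite: BucajEtAl2019, Thm 2.3 and Prop. 3.6] -/
theorem AjankiHuveneers2011_highFrequencyBound_of_anderson (hP : BucajEtAl2019_lyapunovPos)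
    (hV : BucajEtAl2019_vectorLDT) : AjankiHuveneers2011_highFrequencyBound :=
  AjankiHuveneers2011_highFrequencyBound_of_core fun _τ _a _b hyp _ρ _ hρ _ω hω =>
    chain_logMoment_lower hP hV hyp hρ hω le_rfl

end Literature.Barriers.AtomisticToContinuum.HeatConduction


namespace Literature.Barriers.AtomisticToContinuum

open HeatConduction Literature.Probability.RandomMatrixProducts

/-- **The root fact on its remaining trust base.** With the high-frequency bound (H) now proved
from the Anderson-model facts, the vendored barrier fact `AjankiHuveneers2011_scaling`
(Ajanki–Huveneers 2011, Thm 1.1, SDE side) follows from exactly four named facts: Fürstenberg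
positivity and the vectorwise uniform LDT for the one-dimensional Anderson model
(`BucajEtAl2019_lyapunovPos`, `BucajEtAl2019_vectorLDT`), and the two low-frequency bounds of
AH2011 §6 (`AjankiHuveneers2011_lowFrequencyBound` (U), `AjankiHuveneers2011_criticalBandLowerBound`
(L)), everything else in the chain (steady state, current formula, transfer-matrix reduction,
(H)) being proved in this cluster.
[cite: AjankiHuveneers2011, Thm 1.1, §2.1 eqs. (2.5)-(2.7), §6] [cite: BucajEtAl2019, Thm 2.3 and Prop. 3.6] -/
theorem AjankiHuveneers2011_scaling_of_facts (hP : BucajEtAl2019_lyapunovPos)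
    (hV : BucajEtAl2019_vectorLDT) (hU : AjankiHuveneers2011_lowFrequencyBound)
    (hL : AjankiHuveneers2011_criticalBandLowerBound) : AjankiHuveneers2011_scaling :=
  AjankiHuveneers2011_scaling_of_spectralScaling
    (AjankiHuveneers2011_spectralScaling_of_bounds hU
      (AjankiHuveneers2011_highFrequencyBound_of_anderson hP hV) hL)

end Literature.Barriers.AtomisticToContinuum

end
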